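import Literature.Computability.Complexity.CodeFP
import Literature.Computability.Complexity.CodeFPBudgets
import Literature.Computability.Complexity.CodeFPLists
import Literature.Computability.Complexity.IntPairBricks
import Literature.Computability.Complexity.LengthCompare
import Literature.Computability.ImplicitComplexity.SoftTypeAssignmentLmoRename
import Literature.Computability.ImplicitComplexity.SoftTypeAssignmentMachineComplete
import Literature.Computability.ImplicitComplexity.SoftTypeAssignmentRelN
import Literature.Computability.ImplicitComplexity.SoftTypeAssignmentSubstMpxB
import Literature.Computability.ImplicitComplexity.SoftTypeAssignmentSubstRules
import Literature.Computability.ImplicitComplexity.SoftTypeAssignmentTables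
import Literature.Computability.ImplicitComplexity.SoftTypeAssignmentWords
import HarnessLib

/-!
# NP-soundness of `STA₊` (GMR08 Thm. 5.12): soft-sum-representable languages are in NP

One module for the whole soundness half of `STAPlusCapturesNP` (GMR08 = Gaboardi–Marion–Ronchi
Della Rocca 2008, *Soft Linear Logic and Polynomial Complexity Classes*, Thm. 5.12 with Def. 5.13)
above the already separate files of the series (`SoftTypeAssignmentSubst*`, `…Weighted*`,
`…Generation`, `…Machine*`, …). It consists of the following parts, in dependency order, each
with its own section docstring below:

* Part `SubstMpxC` — the `(m)` case and the assembly of the **Substitution Lemma** for weighted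
  `STA₊` derivations (`WTyping.substGoal`; GMR08 Lemma 5.5, GR07 substitution lemma);
* Part `SubjectReduction` — **weighted subject reduction** with strict weight decrease on leftmost
  steps (`WTyping.sr_lmo`, `Typing.subject_reduction`; GMR08 §5);
* Part `PolyBound` — **GMR08 Lemma 5.7**: a typed term of degree `d` admits at most `|M|^(d+1)`
  leftmost steps (`Typing.lmo_steps_le_pow`, `Typing.lmo_normal_form_steps`);
* Parts `MachineImpl`, `MachineImplSim` — the first-order implementation `KAMi` of the sharing
  machine `KAM` (GMR08 Table 6) and its bisimulation with `KAM` (`KAMi.run_init_iff`);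
* Parts `MachineFP`, `MachineFPRun`, `VerifierFP` — the implementation as a `CodeFP` polynomial-time
  function and **the polynomial-time verifier** `KAMi.verifLang ∈ P` (GMR08 Thm. 5.12, machine part);
* Part `NPSound` — the assembly: `SoftSumRepresentsAtLevel.mem_NP`, **GMR08 Thm. 5.12 on the tree's
  classes** (`NP = polyExists P` over `FinTM2` deciders).

## References

* [GaboardiMarionRonchidellarocca2008] GMR08, §3.1, §5, Lemma 5.4, Lemma 5.5, Lemma 5.7, Table 6,
  Thm. 5.12, Def. 5.13.
* [GaboardiRonchiDellaRocca2007] GR07, Substitution Lemma and weighted subject reduction for `STA`.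
* [AroraBarak2009] Def. 2.1 (NP by polynomial-time verifiers).
-/

-- ============================== Part: SubstMpxC ==============================

/-!
## Part `SubstMpxC`: The substitution lemma of `STA₊`, VI: the rule `(m)` and the lemma itself

Conclusion of the Substitution Lemma files (GR07 = Gaboardi–Ronchi Della Rocca 2007, GMR08 =
Gaboardi–Marion–Ronchi Della Rocca 2008):

* `SubstGoal.mpx_notMem` — the `(m)` case when the contracted-into slot is not substituted (the
  multiplexor is replayed below the substitution);
* `SubstGoal.mpx` — the full `(m)` case: move the substituends to fresh slots
  (`Family.exists_swap`, `Family.conj`), then either replay the multiplexor or substitute the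
  renamed copies and contract their variables (`MpxData.solve`), and move back
  (`SubstGoal.conj_back`);
* `WTyping.substGoal` — **the Substitution Lemma**: every weighted derivation satisfies the
  substitution goal for every family, by induction on the derivation, the cases being the lemmas
  of parts I, II and this file. The weight of the result is at most `W(Π) + Σₓ r^{ℓ x} W(Nₓ)`,
  i.e. substitution does not increase the total weight (GMR08 Lemma 5.5/5.6 for `STA₊`, GR07
  Lemma 4.x for `STA`), and the degree is at most the maximum of the degrees involved.

## References

* [GaboardiRonchiDellaRocca2007] GR07, Substitution Lemma.
* [GaboardiMarionRonchidellarocca2008] GMR08, §3.1, Lemma 5.5.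
-/

namespace Literature.Computability.ImplicitComplexity

namespace STA

open Finset

namespace SubstGoal

variable {r : ℕ}

/-- The `(m)` case when the contracted-into slot `j` is not substituted, for a family whose
substituends avoid the premise's slots and `j`: substitute below, multiplex after.
[cite: GaboardiRonchiDellaRocca2007, Substitution Lemma (case (m))] -/
theorem mpx_notMem {w d : ℕ} {Θ₀ : Ctx} {P₀ : Term} {μ σ : SoftTy} {S : Finset ℕ} {j : ℕ}
    (hS : ∀ s ∈ S, Θ₀ s = some σ) (hj : Θ₀ j = none) (hcard : S.card ≤ r)
    (IH : SubstGoal r w d Θ₀ P₀ μ) {X : Finset ℕ} {N : ℕ → Term} {Δ : Ctx} {c ℓ wt e : ℕ → ℕ}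
    (F : Family r (Θ₀.mpx S j σ) X N Δ c ℓ wt e) (hjX : j ∉ X)
    (hfresh : ∀ i, Δ i ≠ none → Θ₀ i = none ∧ i ≠ j) :
    ∃ w' d', w' ≤ w + famCost r X ℓ wt ∧ d' ≤ max d (famDeg X ℓ e) ∧
      WTyping r w' d' (resCtx (Θ₀.mpx S j σ) X Δ c ℓ) ((P₀.rename (mpxRen S j)).substp (famSubst X N)) μ := by
  have hjS : j ∉ S := fun h => by simpa [hj] using hS j h
  have hXS : ∀ x ∈ X, x ∉ S ∧ x ≠ j := fun x hx =>
    ⟨fun h => F.declared hx (Ctx.mpx_of_mem Θ₀ σ h), fun h => hjX (h ▸ hx)⟩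
  have F₀ := F.rebase (Θ' := Θ₀)
    (fun x hx => (Ctx.mpx_of_ne Θ₀ σ (hXS x hx).1 (hXS x hx).2).symm)
    (fun i hi => (hfresh i hi).1)
  obtain ⟨w', d', hw', hd', hD⟩ := IH F₀
  refine ⟨w', d', hw', hd', ?_⟩
  have hΔS : ∀ s ∈ S, Δ s = none := fun s hs => by
    by_contra hne
    simpa [hS s hs] using (hfresh s hne).1
  have hΔj : Δ j = none := by
    by_contra hne
    exact (hfresh j hne).2 rfl
  refine WTyping.mpx (σ := σ) S j hD (fun s hs => ?_) ?_ hcard ?_ ?_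
  · rw [resCtx_apply, if_neg (fun h => (hXS s h).1 hs), hS s hs]
    rfl
  · simp [resCtx_apply, hjX, hj, hΔj]
  · funext i
    by_cases hiS : i ∈ S
    · rw [Ctx.mpx_of_mem _ σ hiS, resCtx_apply, if_neg (fun h => (hXS i h).1 hiS), Ctx.mpx_of_mem Θ₀ σ hiS]
      simp [hΔS i hiS]
    · by_cases hij : i = j
      · subst hij
        rw [Ctx.mpx_self _ σ hiS, resCtx_apply, if_neg hjX, Ctx.mpx_self Θ₀ σ hiS]
        rfl
      · rw [Ctx.mpx_of_ne _ σ hiS hij, resCtx_apply, resCtx_apply, Ctx.mpx_of_ne Θ₀ σ hiS hij]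
  · rw [Term.substp_rename, Term.rename_substp]
    refine Term.substp_congr_fv fun i hi => ?_
    simp only [Function.comp_apply]
    by_cases hiS : i ∈ S
    · have hiX : i ∉ X := fun h => (hXS i h).1 hiS
      rw [mpxRen_of_mem hiS, famSubst_of_not_mem _ hjX, famSubst_of_not_mem _ hiX]
      simp [Term.rename, mpxRen_of_mem hiS]
    · rw [mpxRen_of_not_mem hiS]
      by_cases hiX : i ∈ X
      · rw [famSubst_of_mem _ hiX]
        refine (Term.rename_mpxRen_of_disjoint j fun t ht htS => ?_).symm
        obtain ⟨B, _, hDx⟩ := F.deriv i hiX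
        have h1 : (Δ.part c i) t ≠ none := hDx.ne_none_of_mem_fv ht
        have h2 : Δ t ≠ none := by
          simp only [Ctx.part_apply] at h1
          by_cases h : c t = i
          · simpa [h] using h1
          · simp [h] at h1
        simpa [hS t htS] using (hfresh t h2).1
      · rw [famSubst_of_not_mem _ hiX]
        simp [Term.rename, mpxRen_of_not_mem hiS]

/-- **The `(m)` case of the Substitution Lemma.** [cite: GaboardiRonchiDellaRocca2007, Substitution Lemma (case (m))] -/
theorem mpx {w d : ℕ} {Θ₀ : Ctx} {P₀ : Term} {μ σ : SoftTy} (E₀ : WTyping r w d Θ₀ P₀ μ)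
    {S : Finset ℕ} {j : ℕ} (hS : ∀ s ∈ S, Θ₀ s = some σ) (hj : Θ₀ j = none) (hcard : S.card ≤ r)
    (IH : SubstGoal r w d Θ₀ P₀ μ) : SubstGoal r w d (Θ₀.mpx S j σ) (P₀.rename (mpxRen S j)) μ := by
  intro X N Δ c ℓ wt e F
  have E : WTyping r w d (Θ₀.mpx S j σ) (P₀.rename (mpxRen S j)) μ := WTyping.mpx S j E₀ hS hj hcard rfl rfl
  have hjS : j ∉ S := fun h => by simpa [hj] using hS j h
  -- a finite set of taboo slots: the premise's slots, `j`, the substituted slots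
  obtain ⟨F₀, hF₀⟩ := E₀.exists_support
  have hU : ∀ i, (Θ₀.mpx S j σ) i ≠ none → i ∈ insert j F₀ := by
    intro i hi
    by_cases hij : i = j
    · simp [hij]
    · by_cases hiS : i ∈ S
      · simp [Ctx.mpx_of_mem Θ₀ σ hiS] at hi
      · rw [Ctx.mpx_of_ne Θ₀ σ hiS hij] at hi
        exact mem_insert_of_mem (hF₀ i hi)
  obtain ⟨π, K, hπ, hUK, _, hfix, hmove, _⟩ := F.exists_swap (insert j F₀ ∪ X) fun i hi =>
    mem_union_left _ (hU i hi)
  have hKΘ₀ : ∀ i, Θ₀ i ≠ none → i < K := fun i hi => hUK i (mem_union_left _ (mem_insert_of_mem (hF₀ i hi)))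
  have hKj : j < K := hUK j (mem_union_left _ (mem_insert_self _ _))
  -- move the substituends above `K`
  have hout : ∀ i, Δ i ≠ none → (Θ₀.mpx S j σ) (π i) = none := by
    intro i hi
    by_contra hne
    have h1 := hUK _ (mem_union_left _ (hU _ hne))
    exact not_lt.2 (hmove i hi).1 h1
  have F' := F.conj hπ hout
  have hΔ' : ∀ m, (Δ.remap π) m ≠ none → K ≤ m ∧ m < 2 * K := by
    intro m hm
    rw [Ctx.remap_involutive_apply hπ] at hm
    have := hmove (π m) hm
    rwa [hπ m] at this
  suffices h : ∃ w' d', w' ≤ w + famCost r X ℓ wt ∧ d' ≤ max d (famDeg X ℓ e) ∧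
      WTyping r w' d' (resCtx (Θ₀.mpx S j σ) X (Δ.remap π) (c ∘ π) ℓ)
        ((P₀.rename (mpxRen S j)).substp (famSubst X fun x => (N x).rename π)) μ by
    obtain ⟨w', d', hw', hd', hD⟩ := h
    exact ⟨w', d', hw', hd', SubstGoal.conj_back E F hπ hfix hD⟩
  by_cases hjX : j ∈ X
  · have D : MpxData r Θ₀ S j σ X (fun x => (N x).rename π) (Δ.remap π) (c ∘ π) ℓ wt e K :=
      { hS := hS, hj := hj, F := F', hjX := hjX, hKΘ := hKΘ₀, hKj := hKj,
        hΔlo := fun i hi => (hΔ' i hi).1, hΔhi := fun i hi => (hΔ' i hi).2 }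
    exact D.solve E₀ hcard IH
  · exact mpx_notMem hS hj hcard IH F' hjX fun i hi =>
      ⟨by by_contra hne; exact not_lt.2 (hΔ' i hi).1 (hKΘ₀ i hne),
       fun h => not_lt.2 (hΔ' i hi).1 (h ▸ hKj)⟩

end SubstGoal

/-- **The Substitution Lemma for `STA₊`** (GR07; GMR08 §3, §5), in family form: a weighted
derivation of `Θ ⊢ P : τ` and a family of tight level-`0` derivations for substituted slots
`x : !^{ℓ x} Bₓ` of `Θ` yield a derivation of the substituted term in the result context, of
weight `≤ W(Π) + Σₓ r^{ℓ x} · W(Nₓ)` and degree `≤ max d(Π) (maxₓ (d(Nₓ) + ℓ x))`.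
[cite: GaboardiRonchiDellaRocca2007, Substitution Lemma] -/
theorem WTyping.substGoal {r w d : ℕ} {Θ : Ctx} {P : Term} {τ : SoftTy} (E : WTyping r w d Θ P τ) :
    SubstGoal r w d Θ P τ := by
  induction E with
  | ax h => exact SubstGoal.ax h
  | weak j A E₀ hj hΓ' ih => subst hΓ'; exact SubstGoal.weak E₀ hj A ih
  | lam _ ih => exact SubstGoal.lam ih
  | app hs E₁ E₂ ih₁ ih₂ => exact SubstGoal.app hs E₁ E₂ ih₁ ih₂
  | mpx S j E₀ hS hj hr hΓ' hM' ih => subst hΓ' hM'; exact SubstGoal.mpx E₀ hS hj hr ih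
  | sp _ hΓ' ih => subst hΓ'; exact SubstGoal.sp ih
  | allI _ hΔ ih => subst hΔ; exact SubstGoal.allI ih
  | allE A _ ih => exact SubstGoal.allE A ih
  | sum _ _ ih₁ ih₂ => exact SubstGoal.sum ih₁ ih₂

end STA

end Literature.Computability.ImplicitComplexity

-- ============================== Part: SubjectReduction ==============================

/-!
## Part `SubjectReduction`: Subject reduction for `STA₊` with decreasing weight along the leftmost strategy

The pay-off of the Substitution Lemma files (GR07 = Gaboardi–Ronchi Della Rocca 2007, GMR08 =
Gaboardi–Marion–Ronchi Della Rocca 2008):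

* `WTyping.subst0_lemma` — the β-case: from `Γ₁, x : !ᵏB ⊢ P : A` and `Γ₂ ⊢ N : !ᵏB` with
  `Γ₁ # Γ₂`, a derivation of `Γ₁, Γ₂ ⊢ P[N/x] : A` of weight `≤ W(P) + W(N)` and degree
  `≤ max` (GR07 Substitution Lemma as used in subject reduction; the argument derivation is first
  strengthened and un-boxed `k` times, GMR08 Property 2);
* `WTyping.sr_lmo` — **subject reduction with strictly decreasing weight** for every
  leftmost-outermost step of `Λ₊` (β anywhere the strategy goes, and the two choices at a head
  sum): GMR08 Lemma 5.6 ("in every rule but (h) the weight of the conclusion is strictly greater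
  than the weight of the premises") in the form needed for Lemma 5.7;
* `WTyping.sr_red` — subject reduction for an arbitrary `→βγ` step (weight non-increasing; a
  step inside a branch of a sum need not decrease the `max`);
* `Typing.subject_reduction` — the statement for the tree's judgement: `STA₊` enjoys subject
  reduction, the degree does not increase (GMR08 §5, "the subject reduction property").

## References

* [GaboardiMarionRonchidellarocca2008] GMR08, §3.1 (Lemma 3.4, Thm. 3.5), §5 (subject
  reduction), Lemma 5.6, Lemma 5.7.
* [GaboardiRonchiDellaRocca2007] GR07, Substitution Lemma, Subject Reduction Theorem.
-/

namespace Literature.Computability.ImplicitComplexity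

namespace STA

open Finset

/-! ### Lowering the bound slot to a fresh slot: a cyclic renaming -/

/-- The injective renaming `0 ↦ z`, `i + 1 ↦ i (i < z)`, `i + 1 ↦ i + 1 (i ≥ z)`: it moves the
slot bound by a `λ` to the fresh slot `z` and lowers the outer slots below `z` by one. [folklore] -/
def cycleRen (z : ℕ) : ℕ → ℕ
  | 0 => z
  | i + 1 => if i < z then i else i + 1

/-- The cyclic renaming is injective. [folklore] -/
theorem cycleRen_injective (z : ℕ) : Function.Injective (cycleRen z) := by
  intro a b h
  cases a with
  | zero =>
    cases b with
    | zero => rfl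
    | succ b =>
      simp only [cycleRen] at h
      split_ifs at h <;> omega
  | succ a =>
    cases b with
    | zero =>
      simp only [cycleRen] at h
      split_ifs at h <;> omega
    | succ b =>
      simp only [cycleRen] at h
      split_ifs at h <;> omega

/-- Iterated `!` on contexts, pointwise. [folklore] -/
theorem Ctx.iterate_bang_apply (k : ℕ) : ∀ (Γ : Ctx) (i : ℕ),
    (Ctx.bang^[k] Γ) i = (Γ i).map fun τ => ⟨τ.bangs + k, τ.lin⟩ := by
  induction k with
  | zero =>
    intro Γ i
    cases h : Γ i <;> simp [h]
  | succ k ih =>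
    intro Γ i
    rw [Function.iterate_succ_apply, ih]
    cases h : Γ i with
    | none => simp [Ctx.bang, h]
    | some τ =>
      simp only [Ctx.bang, h, Option.map_some, SoftTy.bang, Option.some.injEq, SoftTy.mk.injEq, and_true]
      omega

/-- Contexts of `STA.Typing` derivations have finite support. [folklore] -/
theorem Typing.exists_support {d : ℕ} {Γ : Ctx} {M : Term} {σ : SoftTy} (h : Typing d Γ M σ) :
    ∃ F : Finset ℕ, ∀ i, Γ i ≠ none → i ∈ F := by
  induction h with
  | @ax Γ i A hΓ =>
    refine ⟨{i}, fun j hj => ?_⟩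
    by_contra hji
    exact hj (hΓ.2 j (by simpa using hji))
  | weak j A _ _ hΓ' ih =>
    subst hΓ'
    obtain ⟨F, hF⟩ := ih
    refine ⟨insert j F, fun i hi => ?_⟩
    by_cases hij : i = j
    · simp [hij]
    · rw [Function.update_of_ne hij] at hi
      exact mem_insert_of_mem (hF i hi)
  | lam _ ih =>
    obtain ⟨F, hF⟩ := ih
    exact ⟨F.image Nat.pred, fun i hi => mem_image.2 ⟨i + 1, hF (i + 1) hi, rfl⟩⟩
  | app hs _ _ ih₁ ih₂ =>
    obtain ⟨F₁, hF₁⟩ := ih₁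
    obtain ⟨F₂, hF₂⟩ := ih₂
    refine ⟨F₁ ∪ F₂, fun i hi => ?_⟩
    rcases hs i with ⟨h₁, _⟩ | ⟨_, h₂⟩
    · exact mem_union_left _ (hF₁ i (h₁ ▸ hi))
    · exact mem_union_right _ (hF₂ i (h₂ ▸ hi))
  | @mpx d Γ Γ' M M' μ σ S j _ _ _ hΓ' _ ih =>
    subst hΓ'
    obtain ⟨F, hF⟩ := ih
    refine ⟨insert j F, fun i hi => ?_⟩
    by_cases hij : i = j
    · simp [hij]
    · by_cases hiS : i ∈ S
      · simp [Ctx.mpx, hiS] at hi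
      · rw [Ctx.mpx_of_ne Γ σ hiS hij] at hi
        exact mem_insert_of_mem (hF i hi)
  | sp _ hΓ' ih =>
    subst hΓ'
    obtain ⟨F, hF⟩ := ih
    exact ⟨F, fun i hi => hF i (by simpa [Ctx.bang] using hi)⟩
  | allI _ hΔ ih =>
    subst hΔ
    obtain ⟨F, hF⟩ := ih
    exact ⟨F, fun i hi => hF i (by simpa [Ctx.shift] using hi)⟩
  | allE A _ ih => exact ih
  | sum _ _ ih₁ _ => exact ih₁

/-! ### The β-case: substitution for the bound slot -/

/-- **Substitution Lemma, β-form** (GR07): `Γ₁, x : !ᵏB ⊢ P : A` (weight `w₁`, degree `d₁`) and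
`Γ₂ ⊢ N : !ᵏB` (weight `w₂`, degree `d₂`) with `Γ₁ # Γ₂` give `Γ ⊢ P[N/x] : A` with weight
`≤ w₁ + w₂` and degree `≤ max d₁ d₂`. [cite: GaboardiRonchiDellaRocca2007, Substitution Lemma] -/
theorem WTyping.subst0_lemma {r w₁ d₁ w₂ d₂ : ℕ} {Γ Γ₁ Γ₂ : Ctx} {P N : Term} {k : ℕ} {B A : LinTy}
    (EP : WTyping r w₁ d₁ (Ctx.cons (some ⟨k, B⟩) Γ₁) P ⟨0, A⟩) (EN : WTyping r w₂ d₂ Γ₂ N ⟨k, B⟩)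
    (hs : Γ.Split Γ₁ Γ₂) :
    ∃ w d, w ≤ w₁ + w₂ ∧ d ≤ max d₁ d₂ ∧ WTyping r w d Γ (P.subst0 N) ⟨0, A⟩ := by
  classical
  -- un-box the (strengthened) argument
  obtain ⟨Γ₀, w₀, d₀, hd₀, hw₀, hΓ₀, ht₀, D₀⟩ := EN.strengthen.unbox_iter (Ctx.tight_restrict Γ₂ N)
  -- a fresh slot `z`
  obtain ⟨F₁, hF₁⟩ := EP.exists_support
  obtain ⟨F₂, hF₂⟩ := EN.exists_support
  set z : ℕ := (F₁ ∪ F₂ ∪ N.fv ∪ P.fv).sup id + 1 with hz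
  have hzΓ₁ : ∀ i, Γ₁ i ≠ none → i < z := fun i hi => by
    have : i + 1 < z := lt_sup_id_succ (by simp [hF₁ (i + 1) (by simpa [Ctx.cons] using hi)])
    omega
  have hzΓ₂ : ∀ i, Γ₂ i ≠ none → i < z := fun i hi => lt_sup_id_succ (by simp [hF₂ i hi])
  have hzN : ∀ i ∈ N.fv, i < z := fun i hi => lt_sup_id_succ (by simp [hi])
  have hzP : ∀ i, i + 1 ∈ P.fv → i < z := fun i hi => by
    have : i + 1 < z := lt_sup_id_succ (by simp [hi])
    omega
  have hΓ₀Γ₂ : ∀ i, Γ₀ i ≠ none → Γ₂ i ≠ none ∧ i ∈ N.fv := by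
    intro i hi
    have h1 : (Ctx.bang^[k] Γ₀) i ≠ none := by
      rw [Ctx.iterate_bang_apply]; simpa using hi
    rw [← hΓ₀] at h1
    simp only [Ctx.restrict_apply] at h1
    by_cases h : i ∈ N.fv
    · exact ⟨by simpa [h] using h1, h⟩
    · simp [h] at h1
  -- move the bound slot to `z`
  have E' := EP.rename (cycleRen_injective z)
  have hΘ' : (Ctx.cons (some ⟨k, B⟩) Γ₁).remap (cycleRen z) = Function.update Γ₁ z (some ⟨k, B⟩) := by
    refine Ctx.remap_eq_of (cycleRen_injective z) _ _ (fun m => ?_) (fun s hs => ?_)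
    · cases m with
      | zero => simp [cycleRen, Ctx.cons]
      | succ i =>
        by_cases hi : i < z
        · simp [cycleRen, hi, Ctx.cons, Function.update_of_ne (Nat.ne_of_lt hi)]
        · have h1 : Γ₁ i = none := by by_contra hne; exact hi (hzΓ₁ i hne)
          have h2 : Γ₁ (i + 1) = none := by by_contra hne; have := hzΓ₁ _ hne; omega
          have h3 : i + 1 ≠ z := by omega
          simp [cycleRen, hi, Ctx.cons, Function.update_of_ne h3, h1, h2]
    · have hsz : s ≠ z := fun e => hs 0 (by simp [cycleRen, e])
      have hs' : Γ₁ s = none := by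
        by_contra hne
        have := hzΓ₁ s hne
        exact hs (s + 1) (by simp [cycleRen, this])
      simp [Function.update_of_ne hsz, hs']
  rw [hΘ'] at E'
  -- the one-slot family
  have F : Family r (Function.update Γ₁ z (some ⟨k, B⟩)) {z} (fun _ => N) Γ₀ (fun _ => z) (fun _ => k)
      (fun _ => w₀) (fun _ => d₀) :=
    { deriv := fun x hx => by
        rw [mem_singleton] at hx
        subst hx
        refine ⟨B, by simp, D₀.of_eq_ctx (funext fun i => by simp)⟩
      tight := fun x hx i hi => by
        rw [mem_singleton] at hx
        subst hx
        exact ht₀ i (by simpa using hi)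
      disjoint := fun i hi => by
        obtain ⟨h1, _⟩ := hΓ₀Γ₂ i hi
        have hiz : i ≠ z := Nat.ne_of_lt (hzΓ₂ i h1)
        rw [Function.update_of_ne hiz]
        exact (hs.right_of_ne_none h1).1
      owned := fun i _ => mem_singleton_self _ }
  obtain ⟨w', d', hw', hd', hD⟩ := E'.substGoal F
  refine ⟨w', d', ?_, ?_, ?_⟩
  · simpa [famCost, hw₀] using hw'
  · simpa [famDeg, hd₀] using hd'
  · -- identify the term …
    have eT : (P.rename (cycleRen z)).substp (famSubst {z} fun _ => N) = P.subst0 N := by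
      rw [Term.substp_rename, Term.subst0]
      refine Term.substp_congr_fv fun m hm => ?_
      cases m with
      | zero => simp [cycleRen, famSubst]
      | succ i =>
        have hi := hzP i hm
        simp [cycleRen, hi, famSubst, Nat.ne_of_lt hi]
    rw [eT] at hD
    -- … and the context, then weaken by the unused part of `Γ₂`
    have hD' := hD.weaken_join Γ₂ F₂ hF₂
    refine hD'.of_eq_ctx (funext fun s => ?_)
    simp only [Ctx.join, resCtx_apply, mem_singleton, Ctx.levelled_apply]
    by_cases hsz : s = z
    · subst hsz
      have h2 : Γ₂ z = none := by by_contra hne; exact lt_irrefl _ (hzΓ₂ z hne)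
      have h1 : Γ₁ z = none := by by_contra hne; exact lt_irrefl _ (hzΓ₁ z hne)
      rw [if_pos rfl, Option.none_or, h2]
      rcases hs z with ⟨e1, _⟩ | ⟨_, e2⟩
      · rw [← e1, h1]
      · rw [← e2, h2]
    · rw [if_neg hsz, Function.update_of_ne hsz]
      have hlev : ((Γ₀ s).map fun τ => (⟨τ.bangs + k, τ.lin⟩ : SoftTy)) = (Γ₂.restrict N.fv) s := by
        rw [hΓ₀, Ctx.iterate_bang_apply]
      rw [hlev]
      rcases hs s with ⟨e1, e2⟩ | ⟨e1, e2⟩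
      · rw [e1, e2]
        cases hΓ : Γ s with
        | none => simp [Ctx.restrict_apply, e2]
        | some τ => simp
      · rw [e1, Option.none_or, Ctx.restrict_apply, e2]
        by_cases hfv : s ∈ N.fv
        · rw [if_pos hfv]
          cases hΓ : Γ s <;> simp
        · rw [if_neg hfv, Option.none_or]

/-! ### Subject reduction -/

/-- **Subject reduction along the leftmost-outermost strategy, with strictly decreasing weight**
(GMR08 Lemma 5.6 in explicit form): if `Π ▹ Γ ⊢ M : σ` in `STA₊` (rank bound `r ≥ 1`) and
`M →ₗ M'` is a leftmost-outermost step (head `β`, either choice of a head sum, or the strategy's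
inner steps), then `Π' ▹ Γ ⊢ M' : σ` with `W(Π', r) < W(Π, r)` and `d(Π') ≤ d(Π)`.
[cite: GaboardiMarionRonchidellarocca2008, Lemma 5.6 and Lemma 5.7] -/
theorem WTyping.sr_lmo {r : ℕ} (hr : 1 ≤ r) {w d : ℕ} {Γ : Ctx} {M : Term} {σ : SoftTy}
    (E : WTyping r w d Γ M σ) : ∀ {M' : Term}, Lmo M M' → ∃ w' d', w' < w ∧ d' ≤ d ∧ WTyping r w' d' Γ M' σ := by
  induction E with
  | ax _ =>
    intro M' hl
    cases hl with
    | hd h => cases h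
  | weak j A _ hj hΓ' ih =>
    intro M' hl
    obtain ⟨w', d', hw, hd, h'⟩ := ih hl
    exact ⟨w', d', hw, hd, WTyping.weak j A h' hj hΓ'⟩
  | lam _ ih =>
    intro M' hl
    obtain ⟨P', hP', rfl⟩ := hl.lam_inv'
    obtain ⟨w', d', hw, hd, h'⟩ := ih hP'
    exact ⟨w' + 1, d', by omega, hd, WTyping.lam h'⟩
  | @app w₁ w₂ d₁ d₂ Γ Γ₁ Γ₂ M N k B A hs E₁ E₂ ih₁ ih₂ =>
    intro M' hl
    rcases hl.app_inv with ⟨P, rfl, rfl⟩ | ⟨M₁, hM₁, rfl⟩ | ⟨N₁, hN₁, rfl⟩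
    · obtain ⟨w₀, rfl, EP⟩ := E₁.gen_lam
      obtain ⟨w', d', hw, hd, h'⟩ := WTyping.subst0_lemma EP E₂ hs
      exact ⟨w', d', by omega, hd, h'⟩
    · obtain ⟨w', d', hw, hd, h'⟩ := ih₁ hM₁
      exact ⟨w' + w₂ + 1, max d' d₂, by omega, max_le_max hd le_rfl, WTyping.app hs h' E₂⟩
    · obtain ⟨w', d', hw, hd, h'⟩ := ih₂ hN₁
      exact ⟨w₁ + w' + 1, max d₁ d', by omega, max_le_max le_rfl hd, WTyping.app hs E₁ h'⟩
  | mpx S j _ hS hj hr' hΓ' hM' ih =>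
    intro M' hl
    subst hΓ' hM'
    obtain ⟨M₂, hM₂, rfl⟩ := Lmo.of_rename hl
    obtain ⟨w', d', hw, hd, h'⟩ := ih hM₂
    exact ⟨w', d', hw, hd, WTyping.mpx S j h' hS hj hr' rfl rfl⟩
  | sp _ hΓ' ih =>
    intro M' hl
    obtain ⟨w', d', hw, hd, h'⟩ := ih hl
    exact ⟨r * w', d' + 1, Nat.mul_lt_mul_of_pos_left hw (by omega), by omega, WTyping.sp h' hΓ'⟩
  | allI _ hΔ ih =>
    intro M' hl
    obtain ⟨w', d', hw, hd, h'⟩ := ih hl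
    exact ⟨w', d', hw, hd, WTyping.allI h' hΔ⟩
  | allE A _ ih =>
    intro M' hl
    obtain ⟨w', d', hw, hd, h'⟩ := ih hl
    exact ⟨w', d', hw, hd, WTyping.allE A h'⟩
  | @sum w₁ w₂ d₁ d₂ Γ M N A E₁ E₂ _ _ =>
    intro M' hl
    rcases hl.sum_inv with rfl | rfl
    · exact ⟨w₁, d₁, by omega, le_max_left _ _, E₁⟩
    · exact ⟨w₂, d₂, by omega, le_max_right _ _, E₂⟩

/-- **Subject reduction for arbitrary `→βγ` steps** (weight non-increasing, degree non-increasing).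
[cite: GaboardiMarionRonchidellarocca2008, §5 (subject reduction for STA₊)] -/
theorem WTyping.sr_red {r : ℕ} {w d : ℕ} {Γ : Ctx} {M : Term} {σ : SoftTy}
    (E : WTyping r w d Γ M σ) : ∀ {M' : Term}, Red M M' → ∃ w' d', w' ≤ w ∧ d' ≤ d ∧ WTyping r w' d' Γ M' σ := by
  induction E with
  | ax _ => intro M' hl; cases hl
  | weak j A _ hj hΓ' ih =>
    intro M' hl
    obtain ⟨w', d', hw, hd, h'⟩ := ih hl
    exact ⟨w', d', hw, hd, WTyping.weak j A h' hj hΓ'⟩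
  | lam _ ih =>
    intro M' hl
    cases hl with
    | lam hP' =>
      obtain ⟨w', d', hw, hd, h'⟩ := ih hP'
      exact ⟨w' + 1, d', by omega, hd, WTyping.lam h'⟩
  | @app w₁ w₂ d₁ d₂ Γ Γ₁ Γ₂ M N k B A hs E₁ E₂ ih₁ ih₂ =>
    intro M' hl
    generalize e : Term.app M N = T at hl
    cases hl with
    | beta P N' =>
      simp only [Term.app.injEq] at e
      obtain ⟨rfl, rfl⟩ := e
      obtain ⟨w₀, rfl, EP⟩ := E₁.gen_lam
      obtain ⟨w', d', hw, hd, h'⟩ := WTyping.subst0_lemma EP E₂ hs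
      exact ⟨w', d', by omega, hd, h'⟩
    | appL N' hM₁ =>
      simp only [Term.app.injEq] at e
      obtain ⟨rfl, rfl⟩ := e
      obtain ⟨w', d', hw, hd, h'⟩ := ih₁ hM₁
      exact ⟨w' + w₂ + 1, max d' d₂, by omega, max_le_max hd le_rfl, WTyping.app hs h' E₂⟩
    | appR M₀ hN₁ =>
      simp only [Term.app.injEq] at e
      obtain ⟨rfl, rfl⟩ := e
      obtain ⟨w', d', hw, hd, h'⟩ := ih₂ hN₁
      exact ⟨w₁ + w' + 1, max d₁ d', by omega, max_le_max le_rfl hd, WTyping.app hs E₁ h'⟩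
    | _ => simp at e
  | mpx S j _ hS hj hr' hΓ' hM' ih =>
    intro M' hl
    subst hΓ' hM'
    obtain ⟨M₂, hM₂, rfl⟩ := Red.of_rename hl
    obtain ⟨w', d', hw, hd, h'⟩ := ih hM₂
    exact ⟨w', d', hw, hd, WTyping.mpx S j h' hS hj hr' rfl rfl⟩
  | sp _ hΓ' ih =>
    intro M' hl
    obtain ⟨w', d', hw, hd, h'⟩ := ih hl
    exact ⟨r * w', d' + 1, Nat.mul_le_mul_left _ hw, by omega, WTyping.sp h' hΓ'⟩
  | allI _ hΔ ih =>
    intro M' hl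
    obtain ⟨w', d', hw, hd, h'⟩ := ih hl
    exact ⟨w', d', hw, hd, WTyping.allI h' hΔ⟩
  | allE A _ ih =>
    intro M' hl
    obtain ⟨w', d', hw, hd, h'⟩ := ih hl
    exact ⟨w', d', hw, hd, WTyping.allE A h'⟩
  | @sum w₁ w₂ d₁ d₂ Γ M N A E₁ E₂ ih₁ ih₂ =>
    intro M' hl
    generalize e : Term.sum M N = T at hl
    cases hl with
    | choiceL P Q =>
      simp only [Term.sum.injEq] at e
      obtain ⟨rfl, rfl⟩ := e
      exact ⟨w₁, d₁, by omega, le_max_left _ _, E₁⟩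
    | choiceR P Q =>
      simp only [Term.sum.injEq] at e
      obtain ⟨rfl, rfl⟩ := e
      exact ⟨w₂, d₂, by omega, le_max_right _ _, E₂⟩
    | sumL Q hP =>
      simp only [Term.sum.injEq] at e
      obtain ⟨rfl, rfl⟩ := e
      obtain ⟨w', d', hw, hd, h'⟩ := ih₁ hP
      exact ⟨max w' w₂ + 1, max d' d₂, by omega, max_le_max hd le_rfl, WTyping.sum h' E₂⟩
    | sumR P hQ =>
      simp only [Term.sum.injEq] at e
      obtain ⟨rfl, rfl⟩ := e
      obtain ⟨w', d', hw, hd, h'⟩ := ih₂ hQ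
      exact ⟨max w₁ w' + 1, max d₁ d', by omega, max_le_max le_rfl hd, WTyping.sum E₁ h'⟩
    | _ => simp at e

/-- **`STA₊` enjoys subject reduction** (GMR08 §5), for the tree's judgement: if `Γ ⊢ M : σ` with
degree `d` and `M →βγ M'` then `Γ ⊢ M' : σ` with degree `≤ d`. [cite: GaboardiMarionRonchidellarocca2008, §5 (subject reduction) and Thm. 3.5] -/
theorem Typing.subject_reduction {d : ℕ} {Γ : Ctx} {M M' : Term} {σ : SoftTy} (h : Typing d Γ M σ)
    (hr : Red M M') : ∃ d', d' ≤ d ∧ Typing d' Γ M' σ := by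
  obtain ⟨w, E⟩ := h.exists_wtyping (r := M.size) le_rfl
  obtain ⟨w', d', _, hd, E'⟩ := E.sr_red hr
  obtain ⟨F, hF⟩ := h.exists_support
  refine ⟨d', hd, ?_⟩
  have := E'.weaken_join Γ F hF
  refine (this.of_eq_ctx (funext fun i => ?_)).typing
  simp only [Ctx.join, Ctx.restrict_apply]
  by_cases hi : i ∈ M.fv
  · rw [if_pos hi]
    cases Γ i <;> simp
  · rw [if_neg hi, Option.none_or]

/-- Subject reduction along `→βγ*`. [cite: GaboardiMarionRonchidellarocca2008, §5 (subject reduction)] -/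
theorem Typing.subject_reduction_reduces {d : ℕ} {Γ : Ctx} {M M' : Term} {σ : SoftTy} (h : Typing d Γ M σ)
    (hr : Reduces M M') : ∃ d', d' ≤ d ∧ Typing d' Γ M' σ := by
  induction hr with
  | refl => exact ⟨d, le_rfl, h⟩
  | tail _ hst ih =>
    obtain ⟨d₁, hd₁, h₁⟩ := ih
    obtain ⟨d₂, hd₂, h₂⟩ := h₁.subject_reduction hst
    exact ⟨d₂, hd₂.trans hd₁, h₂⟩

end STA

end Literature.Computability.ImplicitComplexity

-- ============================== Part: PolyBound ==============================

/-!
## Part `PolyBound`: Polynomial bound on leftmost-outermost evaluations of typed `STA₊` terms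

GMR08 (= Gaboardi–Marion–Ronchi Della Rocca 2008) Lemma 5.7: "`M` can be evaluated to every one
of its normal forms in a number of `βγ`-reduction steps `∈ O(|M|^{d(Π)+1})`". With subject
reduction decreasing the weight at every leftmost-outermost step (`WTyping.sr_lmo`) and the bound
`W(Π, r) ≤ |M| · r^{d(Π)}` at `r = |M|` (`WTyping.weight_le`, `Typing.exists_wtyping_empty`),
every leftmost-outermost reduction sequence of a closed typed term — whatever the choices made at
the sums — has length at most `|M|^{d+1}`:

* `WTyping.lmo_steps` — along `n` leftmost steps the weight drops by at least `n`;
* `Typing.lmo_steps_le_pow` — **Lemma 5.7**: `n ≤ |M| ^ (d + 1)` for closed `⊢ M : σ` of degree `d`;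
* `Typing.lmo_normal_form_steps` — combined with the completeness of the strategy
  (`lmoStar_of_reduces_normal`): every normal form of `M` is reached by a leftmost-outermost
  sequence of length `≤ |M|^{d+1}`.

## References

* [GaboardiMarionRonchidellarocca2008] GMR08, Lemma 5.6, Lemma 5.7, Thm. 3.5.
-/

namespace Literature.Computability.ImplicitComplexity

namespace STA

/-- Along `n` leftmost-outermost steps of a typed term the weight decreases by at least `n`, the
degree does not increase, and the reduct is typed. [cite: GaboardiMarionRonchidellarocca2008, Lemma 5.6] -/
theorem WTyping.lmo_steps {r : ℕ} (hr : 1 ≤ r) {w d : ℕ} {Γ : Ctx} {M : Term} {σ : SoftTy}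
    (E : WTyping r w d Γ M σ) {n : ℕ} {N : Term} (h : RelN Lmo n M N) :
    ∃ w' d', w' + n ≤ w ∧ d' ≤ d ∧ WTyping r w' d' Γ N σ := by
  induction h with
  | refl => exact ⟨w, d, le_rfl, le_rfl, E⟩
  | tail _ hs ih =>
    obtain ⟨w₁, d₁, hw₁, hd₁, E₁⟩ := ih E
    obtain ⟨w₂, d₂, hw₂, hd₂, E₂⟩ := E₁.sr_lmo hr hs
    exact ⟨w₂, d₂, by omega, hd₂.trans hd₁, E₂⟩

/-- The number of leftmost-outermost steps from a typed term is bounded by the weight.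
[cite: GaboardiMarionRonchidellarocca2008, Lemma 5.7] -/
theorem WTyping.lmo_steps_le {r : ℕ} (hr : 1 ≤ r) {w d : ℕ} {Γ : Ctx} {M : Term} {σ : SoftTy}
    (E : WTyping r w d Γ M σ) {n : ℕ} {N : Term} (h : RelN Lmo n M N) : n ≤ w := by
  obtain ⟨w', _, hw, _, _⟩ := E.lmo_steps hr h
  omega

/-- **GMR08 Lemma 5.7 (polynomial length of leftmost evaluations).** For a closed `STA₊` term
`⊢ M : σ` typed with degree `d`, every leftmost-outermost reduction sequence (with arbitrary
choices at the sums) has length at most `|M| ^ (d + 1)`. [cite: GaboardiMarionRonchidellarocca2008, Lemma 5.7] -/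
theorem Typing.lmo_steps_le_pow {d : ℕ} {M : Term} {σ : SoftTy} (h : Typing d Ctx.empty M σ)
    {n : ℕ} {N : Term} (hs : RelN Lmo n M N) : n ≤ M.size ^ (d + 1) := by
  have hr : 1 ≤ M.size := M.size_pos
  obtain ⟨w, E⟩ := h.exists_wtyping_empty (r := M.size) le_rfl
  calc n ≤ w := E.lmo_steps_le hr hs
    _ ≤ M.size * M.size ^ d := E.weight_le hr
    _ = M.size ^ (d + 1) := by ring

/-- Typing is preserved along leftmost evaluations of closed terms, the degree does not increase.
[cite: GaboardiMarionRonchidellarocca2008, §5 (subject reduction)] -/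
theorem Typing.lmo_steps_typing {d : ℕ} {M : Term} {σ : SoftTy} (h : Typing d Ctx.empty M σ)
    {n : ℕ} {N : Term} (hs : RelN Lmo n M N) : ∃ d', d' ≤ d ∧ Typing d' Ctx.empty N σ := by
  obtain ⟨w, E⟩ := h.exists_wtyping_empty (r := M.size) le_rfl
  obtain ⟨w', d', _, hd, E'⟩ := E.lmo_steps M.size_pos hs
  exact ⟨d', hd, E'.typing⟩

/-- **Every normal form of a closed typed term is reached by a leftmost-outermost evaluation of
polynomial length**: if `⊢ M : σ` with degree `d` and `M →βγ* N` with `N` normal, then some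
leftmost-outermost sequence of length `≤ |M|^{d+1}` leads from `M` to `N`
(GMR08 Lemma 5.4 + Lemma 5.7). [cite: GaboardiMarionRonchidellarocca2008, Lemma 5.4 and Lemma 5.7] -/
theorem Typing.lmo_normal_form_steps {d : ℕ} {M : Term} {σ : SoftTy} (h : Typing d Ctx.empty M σ)
    {N : Term} (hred : Reduces M N) (hN : Normal N) : ∃ n, n ≤ M.size ^ (d + 1) ∧ RelN Lmo n M N := by
  obtain ⟨n, hn⟩ := RelN.of_reflTransGen (lmoStar_of_reduces_normal hred hN)
  exact ⟨n, h.lmo_steps_le_pow hn, hn⟩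

/-- The size of the word datum `s̲`: `|s̲| = 6 |s| + 3`. [cite: GaboardiMarionRonchidellarocca2008, §3.2] -/
theorem size_encWord (w : List Bool) : (encWord w).size = 6 * w.length + 3 := by
  unfold encWord
  have : ∀ bs : List Bool, (bs.foldr (fun b r => Term.app (.app (.var 1) (encBit b)) r) (.var 0)).size
      = 6 * bs.length + 1 := by
    intro bs
    induction bs with
    | nil => rfl
    | cons b bs ih =>
      simp only [List.foldr_cons, Term.size, ih, List.length_cons]
      cases b <;> simp [encBit, zero, one, Term.size] <;> ring
  simp +arith only [Term.size, this]

/-- **Polynomial evaluation of applied programs.** For a closed program `⊢ M : !ⁿ S ⊸ B` of degree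
`d` and an input word `s`, every normal form of `M s̲` reachable by any `βγ`-sequence is reached by
a leftmost-outermost evaluation of length at most `(|M| + 6|s| + 4)^{max d n + 1}` — polynomial
in `|s|` with exponent the level of the program. [cite: GaboardiMarionRonchidellarocca2008, Lemma 5.7 and Thm. 5.12] -/
theorem Typing.lmo_steps_app_encWord {d n : ℕ} {M : Term} (h : Typing d Ctx.empty M (progTy n 1))
    (s : List Bool) {N : Term} (hred : Reduces (.app M (encWord s)) N) (hN : Normal N) :
    ∃ k, k ≤ (M.size + 6 * s.length + 4) ^ (max d n + 1) ∧ RelN Lmo k (.app M (encWord s)) N := by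
  have hT := typing_app_encWord h s
  obtain ⟨k, hk, hs⟩ := hT.lmo_normal_form_steps hred hN
  refine ⟨k, hk.trans ?_, hs⟩
  have : (Term.app M (encWord s)).size = M.size + 6 * s.length + 4 := by
    simp [Term.size, size_encWord]; ring
  rw [this]

end STA

end Literature.Computability.ImplicitComplexity

-- ============================== Part: MachineImpl ==============================

/-!
## Part `MachineImpl`: A sharing abstract machine for `STA₊`, VI: the first-order implementation

The machine `STA.KAM` (GMR08 = Gaboardi–Marion–Ronchi Della Rocca 2008, Table 6) manipulates terms;
its polynomial-time implementation manipulates numbers and lists only. This file defines that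
implementation and proves it bisimilar to `KAM`:

* `STA.KAMi.IState` — first-order states: the code as a POSITION in the node table of the initial
  term (`STA.Term.nodes`), the environment as a list of heap pointers, the stack as a list of
  closures `code :: env`, the heap as a list of cells `tag :: content :: env` (`0 :: n :: e` for a
  closure with code position `n`, `[1, ℓ]` for the abstract variable of level `ℓ`), the depth,
  the remaining oracle bits, and a status (`0` running, `1` accepted, `2` rejected);
* `STA.KAMi.istep` — one total transition on first-order states (table look-ups with defaults);
* the equations of `istep` in each configuration (`istep_app`, `istep_beta`, …).

The correspondence with `KAM` (`KAMi.Sim`, `KAMi.run_init_iff`) is Part `MachineImplSim` of this file.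

## References

* [GaboardiMarionRonchidellarocca2008] GMR08, §5.1, Table 6 (the machine), Thm. 5.12 (it runs in
  polynomial time on a Turing machine).
-/

namespace Literature.Computability.ImplicitComplexity

namespace STA

namespace KAMi

/-- First-order machine states. [folklore] -/
structure IState : Type where
  /-- position of the code in the node table -/
  code : ℕ
  /-- heap pointers for the free indices of the code -/
  env : List ℕ
  /-- pending arguments: closures `code :: env` -/
  stk : List (List ℕ)
  /-- heap cells `tag :: content :: env` -/
  hp : List (List ℕ)
  /-- abstractions entered -/
  depth : ℕ
  /-- remaining oracle bits, as `0`/`1` -/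
  orc : List ℕ
  /-- status: `0` running, `1` accepted, `2` rejected -/
  st : ℕ

/-- The three columns of the node table of a term. [folklore] -/
def tags (T : Term) : List ℕ := (T.nodes 0).map fun n => n.1
/-- The three columns of the node table of a term. [folklore] -/
def argA (T : Term) : List ℕ := (T.nodes 0).map fun n => n.2.1
/-- The three columns of the node table of a term. [folklore] -/
def argB (T : Term) : List ℕ := (T.nodes 0).map fun n => n.2.2

/-- Reading the columns at a position of the table. [folklore] -/
theorem cols_of_getElem? {T : Term} {k a b c : ℕ} (h : (T.nodes 0)[k]? = some (a, b, c)) :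
    (tags T).getD k 0 = a ∧ (argA T).getD k 0 = b ∧ (argB T).getD k 0 = c := by
  simp [tags, argA, argB, List.getD_eq_getElem?_getD, List.getElem?_map, h]

/-- **One transition on first-order states** (total: out-of-table look-ups default and reject).
[cite: GaboardiMarionRonchidellarocca2008, Table 6] -/
def istep (tg na nb : List ℕ) (s : IState) : IState :=
  if s.st = 0 then
    if tg.getD s.code 0 = 1 then
      ⟨na.getD s.code 0, s.env, (nb.getD s.code 0 :: s.env) :: s.stk, s.hp, s.depth, s.orc, 0⟩
    else if tg.getD s.code 0 = 2 then
      if s.stk.isEmpty then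
        if s.depth < 2 then ⟨na.getD s.code 0, s.hp.length :: s.env, s.stk, s.hp ++ [[1, s.depth]], s.depth + 1, s.orc, 0⟩
        else ⟨s.code, s.env, s.stk, s.hp, s.depth, s.orc, 2⟩
      else ⟨na.getD s.code 0, s.hp.length :: s.env, s.stk.tail, s.hp ++ [0 :: s.stk.headD []], s.depth, s.orc, 0⟩
    else if tg.getD s.code 0 = 3 then
      if s.orc.isEmpty then ⟨s.code, s.env, s.stk, s.hp, s.depth, s.orc, 2⟩
      else ⟨if s.orc.headD 0 = 1 then nb.getD s.code 0 else na.getD s.code 0, s.env, s.stk, s.hp, s.depth, s.orc.tail, 0⟩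
    else
      if na.getD s.code 0 < s.env.length then
        if s.env.getD (na.getD s.code 0) 0 < s.hp.length then
          if (s.hp.getD (s.env.getD (na.getD s.code 0) 0) []).headD 0 = 0 then
            ⟨((s.hp.getD (s.env.getD (na.getD s.code 0) 0) []).tail).headD 0,
              ((s.hp.getD (s.env.getD (na.getD s.code 0) 0) []).tail).tail, s.stk, s.hp, s.depth, s.orc, 0⟩
          else if s.stk.isEmpty ∧ s.depth = 2 ∧ ((s.hp.getD (s.env.getD (na.getD s.code 0) 0) []).tail).headD 0 = 0 then
            ⟨s.code, s.env, s.stk, s.hp, s.depth, s.orc, 1⟩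
          else ⟨s.code, s.env, s.stk, s.hp, s.depth, s.orc, 2⟩
        else ⟨s.code, s.env, s.stk, s.hp, s.depth, s.orc, 2⟩
      else ⟨s.code, s.env, s.stk, s.hp, s.depth, s.orc, 2⟩
  else s

/-- Bits as `0`/`1`. [folklore] -/
def bitNat (b : Bool) : ℕ := if b then 1 else 0

/-- The initial first-order state of a term and an oracle. [folklore] -/
def iinit (o : List Bool) : IState := ⟨0, [], [], [], 0, o.map bitNat, 0⟩

/-- A halted state stays. [folklore] -/
theorem istep_of_ne {tg na nb : List ℕ} {s : IState} (h : s.st ≠ 0) : istep tg na nb s = s := by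
  simp [istep, h]

/-- A halted state stays, iterated. [folklore] -/
theorem iterate_of_ne {tg na nb : List ℕ} {s : IState} (h : s.st ≠ 0) : ∀ n, (istep tg na nb)^[n] s = s
  | 0 => rfl
  | n + 1 => by rw [Function.iterate_succ_apply, istep_of_ne h, iterate_of_ne h n]

/-! ### Equations of the first-order transition -/

section eqns

variable {tg na nb : List ℕ} {c : ℕ} {env : List ℕ} {stk hp : List (List ℕ)} {d : ℕ} {orc : List ℕ}

/-- Push. [folklore] -/
theorem istep_app (htg : tg.getD c 0 = 1) :
    istep tg na nb ⟨c, env, stk, hp, d, orc, 0⟩ = ⟨na.getD c 0, env, (nb.getD c 0 :: env) :: stk, hp, d, orc, 0⟩ := by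
  simp only [List.getD_eq_getElem?_getD] at htg ⊢
  simp [istep, htg]

/-- β. [folklore] -/
theorem istep_beta (htg : tg.getD c 0 = 2) (x : List ℕ) :
    istep tg na nb ⟨c, env, x :: stk, hp, d, orc, 0⟩ = ⟨na.getD c 0, hp.length :: env, stk, hp ++ [0 :: x], d, orc, 0⟩ := by
  simp only [List.getD_eq_getElem?_getD] at htg ⊢
  simp [istep, htg]

/-- Enter an abstraction. [folklore] -/
theorem istep_enter (htg : tg.getD c 0 = 2) (hd : d < 2) :
    istep tg na nb ⟨c, env, [], hp, d, orc, 0⟩ = ⟨na.getD c 0, hp.length :: env, [], hp ++ [[1, d]], d + 1, orc, 0⟩ := by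
  simp only [List.getD_eq_getElem?_getD] at htg ⊢
  simp [istep, htg, hd]

/-- Too many abstractions. [folklore] -/
theorem istep_enter_fail (htg : tg.getD c 0 = 2) (hd : ¬ d < 2) :
    (istep tg na nb ⟨c, env, [], hp, d, orc, 0⟩).st = 2 := by
  simp only [List.getD_eq_getElem?_getD] at htg
  simp [istep, htg, hd]

/-- Sum without oracle. [folklore] -/
theorem istep_sum_nil (htg : tg.getD c 0 = 3) : (istep tg na nb ⟨c, env, stk, hp, d, [], 0⟩).st = 2 := by
  simp only [List.getD_eq_getElem?_getD] at htg
  simp [istep, htg]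

/-- Sum with oracle. [folklore] -/
theorem istep_sum_cons (htg : tg.getD c 0 = 3) (b : Bool) (o' : List ℕ) :
    istep tg na nb ⟨c, env, stk, hp, d, bitNat b :: o', 0⟩ = ⟨if b then nb.getD c 0 else na.getD c 0, env, stk, hp, d, o', 0⟩ := by
  simp only [List.getD_eq_getElem?_getD] at htg ⊢
  cases b <;> simp [istep, htg, bitNat]

/-- Variable: unfolding. [folklore] -/
theorem istep_var (htg : tg.getD c 0 = 0) :
    istep tg na nb ⟨c, env, stk, hp, d, orc, 0⟩ =
      (if na.getD c 0 < env.length then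
        if env.getD (na.getD c 0) 0 < hp.length then
          if (hp.getD (env.getD (na.getD c 0) 0) []).headD 0 = 0 then
            ⟨((hp.getD (env.getD (na.getD c 0) 0) []).tail).headD 0,
              ((hp.getD (env.getD (na.getD c 0) 0) []).tail).tail, stk, hp, d, orc, 0⟩
          else if stk.isEmpty ∧ d = 2 ∧ ((hp.getD (env.getD (na.getD c 0) 0) []).tail).headD 0 = 0 then
            ⟨c, env, stk, hp, d, orc, 1⟩
          else ⟨c, env, stk, hp, d, orc, 2⟩
        else ⟨c, env, stk, hp, d, orc, 2⟩
      else ⟨c, env, stk, hp, d, orc, 2⟩) := by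
  have h1 : ¬ tg.getD c 0 = 1 := by rw [htg]; decide
  have h2 : ¬ tg.getD c 0 = 2 := by rw [htg]; decide
  have h3 : ¬ tg.getD c 0 = 3 := by rw [htg]; decide
  simp only [istep, if_true, h1, h2, h3, if_false]

/-- Variable, unbound. [folklore] -/
theorem istep_var_env (htg : tg.getD c 0 = 0) (hi : ¬ na.getD c 0 < env.length) :
    (istep tg na nb ⟨c, env, stk, hp, d, orc, 0⟩).st = 2 := by
  rw [istep_var htg, if_neg hi]

/-- Variable, dangling pointer. [folklore] -/
theorem istep_var_heap (htg : tg.getD c 0 = 0) (hi : na.getD c 0 < env.length)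
    (hc : ¬ env.getD (na.getD c 0) 0 < hp.length) : (istep tg na nb ⟨c, env, stk, hp, d, orc, 0⟩).st = 2 := by
  rw [istep_var htg, if_pos hi, if_neg hc]

/-- Variable bound to a closure: look it up. [folklore] -/
theorem istep_var_clo (htg : tg.getD c 0 = 0) (hi : na.getD c 0 < env.length)
    (hc : env.getD (na.getD c 0) 0 < hp.length) {n : ℕ} {e : List ℕ}
    (hD : hp.getD (env.getD (na.getD c 0) 0) [] = 0 :: n :: e) :
    istep tg na nb ⟨c, env, stk, hp, d, orc, 0⟩ = ⟨n, e, stk, hp, d, orc, 0⟩ := by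
  rw [istep_var htg, if_pos hi, if_pos hc, hD]
  simp only [List.headD_cons, List.tail_cons, if_true]

/-- Variable bound to an abstract variable: halt. [folklore] -/
theorem istep_var_abs (htg : tg.getD c 0 = 0) (hi : na.getD c 0 < env.length)
    (hc : env.getD (na.getD c 0) 0 < hp.length) {ℓ : ℕ} (hD : hp.getD (env.getD (na.getD c 0) 0) [] = [1, ℓ]) :
    (istep tg na nb ⟨c, env, stk, hp, d, orc, 0⟩).st = if stk.isEmpty ∧ d = 2 ∧ ℓ = 0 then 1 else 2 := by
  rw [istep_var htg, if_pos hi, if_pos hc, hD]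
  simp only [List.headD_cons, List.tail_cons]
  rw [if_neg (by decide : ¬ (1 : ℕ) = 0)]
  split_ifs <;> rfl

end eqns

end KAMi

end STA

end Literature.Computability.ImplicitComplexity

-- ============================== Part: MachineImplSim ==============================

/-!
## Part `MachineImplSim`: A sharing abstract machine for `STA₊`, VII: the implementation is bisimilar to the machine

Continuation of Part `MachineImpl` of this file (GMR08 = Gaboardi–Marion–Ronchi Della Rocca
2008, Table 6). The correspondence `KAMi.Sim T s k o` between a first-order state `s` (codes as
positions in the node table of `T`) and a state `k` of `STA.KAM` with oracle `o` is preserved by a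
transition and detects halting with the right status (`KAMi.istep_sim`); consequently
`KAM.run n o (KAM.init T) = true` iff after `n` iterations of `KAMi.istep` from the initial
first-order state the status is `1` (`KAMi.run_init_iff`).

## References

* [GaboardiMarionRonchidellarocca2008] GMR08, §5.1, Table 6, Thm. 5.12.
-/

namespace Literature.Computability.ImplicitComplexity

namespace STA

namespace KAMi

/-! ### The correspondence with `KAM` -/

/-- **Correspondence** between a first-order state and a `KAM` state with its oracle. [folklore] -/
structure Sim (T : Term) (s : IState) (k : KAM.State) (o : List Bool) : Prop where
  /-- the code position carries the code -/
  code : T.sub s.code = some k.code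
  /-- same environment -/
  env : s.env = k.env
  /-- same stack length -/
  stkLen : s.stk.length = k.stack.length
  /-- stack items correspond -/
  stk : ∀ (j : ℕ) (cl : Term × List ℕ), k.stack[j]? = some cl → ∃ c, s.stk[j]? = some (c :: cl.2) ∧ T.sub c = some cl.1
  /-- same heap length -/
  hpLen : s.hp.length = k.heap.length
  /-- closure cells correspond -/
  hpClo : ∀ (c : ℕ) (t : Term) (e : List ℕ), k.heap[c]? = some (KAM.Entry.clo t e) →
    ∃ n, s.hp[c]? = some (0 :: n :: e) ∧ T.sub n = some t
  /-- abstract-variable cells correspond -/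
  hpAbs : ∀ (c ℓ : ℕ), k.heap[c]? = some (KAM.Entry.abs ℓ) → s.hp[c]? = some [1, ℓ]
  /-- same depth -/
  depth : s.depth = k.depth
  /-- the oracle -/
  orc : s.orc = o.map bitNat
  /-- running -/
  st : s.st = 0

/-- The initial states correspond. [folklore] -/
theorem sim_init (T : Term) (o : List Bool) : Sim T (iinit o) (KAM.init T) o where
  code := by simp [iinit, KAM.init]
  env := rfl
  stkLen := rfl
  stk := by simp [KAM.init]
  hpLen := rfl
  hpClo := by simp [KAM.init]
  hpAbs := by simp [KAM.init]
  depth := rfl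
  orc := rfl
  st := rfl

section sim

variable {T : Term} {s : IState} {k : KAM.State} {o : List Bool}

/-- Extending both heaps by corresponding closure cells. [folklore] -/
theorem heaps_snoc_clo {shp : List (List ℕ)} {heap : List KAM.Entry} (hlen : shp.length = heap.length)
    (hClo : ∀ (c : ℕ) (t : Term) (e : List ℕ), heap[c]? = some (KAM.Entry.clo t e) → ∃ n, shp[c]? = some (0 :: n :: e) ∧ T.sub n = some t)
    (hAbs : ∀ (c ℓ : ℕ), heap[c]? = some (KAM.Entry.abs ℓ) → shp[c]? = some [1, ℓ])
    {n : ℕ} {t : Term} {e : List ℕ} (hn : T.sub n = some t) :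
    (∀ (c : ℕ) (t' : Term) (e' : List ℕ), (heap ++ [KAM.Entry.clo t e])[c]? = some (KAM.Entry.clo t' e') →
      ∃ n', (shp ++ [0 :: n :: e])[c]? = some (0 :: n' :: e') ∧ T.sub n' = some t') ∧
    (∀ (c ℓ : ℕ), (heap ++ [KAM.Entry.clo t e])[c]? = some (KAM.Entry.abs ℓ) → (shp ++ [0 :: n :: e])[c]? = some [1, ℓ]) := by
  constructor
  · intro c' t' e' hget
    rcases Nat.lt_or_ge c' heap.length with hlt | hge
    · rw [List.getElem?_append_left hlt] at hget
      obtain ⟨n', hn1, hn2⟩ := hClo c' t' e' hget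
      exact ⟨n', by rw [List.getElem?_append_left (by omega), hn1], hn2⟩
    · obtain ⟨rfl, hx⟩ := KAM.getElem?_snoc_of_ge hge hget
      simp only [KAM.Entry.clo.injEq] at hx
      obtain ⟨rfl, rfl⟩ := hx
      refine ⟨n, ?_, hn⟩
      rw [List.getElem?_append_right (by omega), hlen, Nat.sub_self]
      rfl
  · intro c' ℓ hget
    rcases Nat.lt_or_ge c' heap.length with hlt | hge
    · rw [List.getElem?_append_left hlt] at hget
      rw [List.getElem?_append_left (by omega)]
      exact hAbs c' ℓ hget
    · obtain ⟨_, hx⟩ := KAM.getElem?_snoc_of_ge hge hget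
      cases hx

/-- Extending both heaps by corresponding abstract-variable cells. [folklore] -/
theorem heaps_snoc_abs {shp : List (List ℕ)} {heap : List KAM.Entry} (hlen : shp.length = heap.length)
    (hClo : ∀ (c : ℕ) (t : Term) (e : List ℕ), heap[c]? = some (KAM.Entry.clo t e) → ∃ n, shp[c]? = some (0 :: n :: e) ∧ T.sub n = some t)
    (hAbs : ∀ (c ℓ : ℕ), heap[c]? = some (KAM.Entry.abs ℓ) → shp[c]? = some [1, ℓ]) (d : ℕ) :
    (∀ (c : ℕ) (t' : Term) (e' : List ℕ), (heap ++ [KAM.Entry.abs d])[c]? = some (KAM.Entry.clo t' e') →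
      ∃ n', (shp ++ [[1, d]])[c]? = some (0 :: n' :: e') ∧ T.sub n' = some t') ∧
    (∀ (c ℓ : ℕ), (heap ++ [KAM.Entry.abs d])[c]? = some (KAM.Entry.abs ℓ) → (shp ++ [[1, d]])[c]? = some [1, ℓ]) := by
  constructor
  · intro c' t' e' hget
    rcases Nat.lt_or_ge c' heap.length with hlt | hge
    · rw [List.getElem?_append_left hlt] at hget
      obtain ⟨n', hn1, hn2⟩ := hClo c' t' e' hget
      exact ⟨n', by rw [List.getElem?_append_left (by omega), hn1], hn2⟩
    · obtain ⟨_, hx⟩ := KAM.getElem?_snoc_of_ge hge hget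
      cases hx
  · intro c' ℓ hget
    rcases Nat.lt_or_ge c' heap.length with hlt | hge
    · rw [List.getElem?_append_left hlt] at hget
      rw [List.getElem?_append_left (by omega)]
      exact hAbs c' ℓ hget
    · obtain ⟨rfl, hx⟩ := KAM.getElem?_snoc_of_ge hge hget
      simp only [KAM.Entry.abs.injEq] at hx
      subst hx
      rw [List.getElem?_append_right (by omega), hlen, Nat.sub_self]
      rfl

/-- **A transition preserves the correspondence** (and halts with the right status).
[cite: GaboardiMarionRonchidellarocca2008, Table 6] -/
theorem istep_sim (h : Sim T s k o) :
    match KAM.step o k with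
    | .go o' k' => Sim T (istep (tags T) (argA T) (argB T) s) k' o'
    | .accept => (istep (tags T) (argA T) (argB T) s).st = 1
    | .reject => (istep (tags T) (argA T) (argB T) s).st = 2 := by
  obtain ⟨sc, senv, sstk, shp, sdepth, sorc, sst⟩ := s
  obtain ⟨hcode, henv, hstkLen, hstk, hhpLen, hhpClo, hhpAbs, hdepth, horc, hst⟩ := h
  dsimp only at hcode henv hstkLen hstk hhpLen hhpClo hhpAbs hdepth horc hst
  subst henv hdepth horc hst
  obtain ⟨code, env, stack, heap, depth⟩ := k
  dsimp only at hcode hstkLen hstk hhpLen hhpClo hhpAbs ⊢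
  cases code with
  | app t u =>
    obtain ⟨hn, ha, hb⟩ := Term.table_app hcode
    obtain ⟨htg, hna, hnb⟩ := cols_of_getElem? hn
    simp only [KAM.step]
    rw [istep_app htg, hna, hnb]
    refine ⟨ha, rfl, by simp [hstkLen], ?_, hhpLen, hhpClo, hhpAbs, rfl, rfl, rfl⟩
    intro j cl hj
    cases j with
    | zero =>
      simp only [List.getElem?_cons_zero, Option.some.injEq] at hj
      subst hj
      exact ⟨_, by simp, hb⟩
    | succ j => simpa using hstk j cl (by simpa using hj)
  | lam t =>
    obtain ⟨hn, ha⟩ := Term.table_lam hcode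
    obtain ⟨htg, hna, _⟩ := cols_of_getElem? hn
    cases stack with
    | cons c S =>
      obtain ⟨c0, hc0, hc0'⟩ := hstk 0 c (by simp)
      obtain ⟨st0, srest, hsstk⟩ : ∃ x rest, sstk = x :: rest := by
        cases sstk with
        | nil => simp at hstkLen
        | cons x rest => exact ⟨x, rest, rfl⟩
      subst hsstk
      simp only [List.getElem?_cons_zero, Option.some.injEq] at hc0
      subst hc0
      simp only [KAM.step]
      rw [istep_beta htg, hna]
      obtain ⟨h1, h2⟩ := heaps_snoc_clo hhpLen hhpClo hhpAbs hc0' (e := c.2)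
      refine ⟨ha, by simp [hhpLen], by simpa using hstkLen, fun j cl hj => hstk (j + 1) cl (by simpa using hj),
        by simp [hhpLen], h1, h2, rfl, rfl, rfl⟩
    | nil =>
      have hsnil : sstk = [] := by simpa using hstkLen
      subst hsnil
      by_cases hd : depth < 2
      · simp only [KAM.step, hd, if_true]
        rw [istep_enter htg hd, hna]
        obtain ⟨h1, h2⟩ := heaps_snoc_abs hhpLen hhpClo hhpAbs depth
        exact ⟨ha, by simp [hhpLen], rfl, by simp, by simp [hhpLen], h1, h2, rfl, rfl, rfl⟩
      · simp only [KAM.step, hd, if_false]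
        exact istep_enter_fail htg hd
  | sum t u =>
    obtain ⟨hn, ha, hb⟩ := Term.table_sum hcode
    obtain ⟨htg, hna, hnb⟩ := cols_of_getElem? hn
    cases o with
    | nil =>
      simp only [KAM.step]
      exact istep_sum_nil htg
    | cons bb o' =>
      simp only [KAM.step, List.map_cons]
      rw [istep_sum_cons htg, hna, hnb]
      refine ⟨?_, rfl, hstkLen, hstk, hhpLen, hhpClo, hhpAbs, rfl, rfl, rfl⟩
      cases bb <;> simp [ha, hb]
  | var i =>
    have hn := Term.table_var hcode
    obtain ⟨htg, hna, _⟩ := cols_of_getElem? hn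
    rcases hget : env[i]? with _ | c
    · have hi : ¬ i < env.length := fun h => by
        rw [List.getElem?_eq_none_iff] at hget; omega
      simp only [KAM.step, hget]
      exact istep_var_env htg (by rwa [hna])
    · have hi : i < env.length := by
        by_contra h
        rw [List.getElem?_eq_none_iff.2 (not_lt.1 h)] at hget
        cases hget
      have hgetD : env.getD i 0 = c := by rw [List.getD_eq_getElem?_getD, hget]; rfl
      have hi' : (argA T).getD sc 0 < env.length := by rwa [hna]
      rcases hcell : heap[c]? with _ | ⟨t', env'⟩ | ℓ
      · have hc : ¬ env.getD ((argA T).getD sc 0) 0 < shp.length := fun h => by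
          rw [hna, hgetD, hhpLen] at h
          rw [List.getElem?_eq_none_iff] at hcell; omega
        simp only [KAM.step, hget, hcell]
        exact istep_var_heap htg hi' hc
      · obtain ⟨n, hn1, hn2⟩ := hhpClo c t' env' hcell
        have hc : env.getD ((argA T).getD sc 0) 0 < shp.length := by
          rw [hna, hgetD]
          by_contra h
          rw [List.getElem?_eq_none_iff.2 (not_lt.1 h)] at hn1
          cases hn1
        have hD : shp.getD (env.getD ((argA T).getD sc 0) 0) [] = 0 :: n :: env' := by
          rw [hna, hgetD, List.getD_eq_getElem?_getD, hn1]; rfl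
        simp only [KAM.step, hget, hcell]
        rw [istep_var_clo htg hi' hc hD]
        exact ⟨hn2, rfl, hstkLen, hstk, hhpLen, hhpClo, hhpAbs, rfl, rfl, rfl⟩
      · have hA := hhpAbs c ℓ hcell
        have hc : env.getD ((argA T).getD sc 0) 0 < shp.length := by
          rw [hna, hgetD]
          by_contra h
          rw [List.getElem?_eq_none_iff.2 (not_lt.1 h)] at hA
          cases hA
        have hD : shp.getD (env.getD ((argA T).getD sc 0) 0) [] = [1, ℓ] := by
          rw [hna, hgetD, List.getD_eq_getElem?_getD, hA]; rfl
        have hempty : sstk.isEmpty = stack.isEmpty := by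
          cases sstk with
          | nil =>
            cases stack with
            | nil => rfl
            | cons _ _ => simp at hstkLen
          | cons _ _ =>
            cases stack with
            | nil => simp at hstkLen
            | cons _ _ => rfl
        have hval := istep_var_abs (nb := argB T) (orc := o.map bitNat) htg hi' hc hD (stk := sstk) (d := depth)
        rw [hempty] at hval
        simp only [KAM.step, hget, hcell]
        by_cases hcond : stack.isEmpty ∧ depth = 2 ∧ ℓ = 0
        · rw [if_pos hcond] at hval ⊢
          exact hval
        · rw [if_neg hcond] at hval ⊢
          exact hval

end sim

/-- **The implementation decides like the machine**: the machine accepts within `n` transitions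
iff the status after `n` first-order transitions is `1`. [cite: GaboardiMarionRonchidellarocca2008, Thm. 5.12] -/
theorem run_iff_iterate (T : Term) : ∀ (n : ℕ) (s : IState) (k : KAM.State) (o : List Bool), Sim T s k o →
    (KAM.run n o k = true ↔ ((istep (tags T) (argA T) (argB T))^[n] s).st = 1) := by
  intro n
  induction n with
  | zero =>
    intro s k o h
    simp [KAM.run, h.st]
  | succ n ih =>
    intro s k o h
    have hsim := istep_sim h
    rw [Function.iterate_succ_apply]
    simp only [KAM.run]
    rcases hs : KAM.step o k with ⟨o', k'⟩ | _ | _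
    · rw [hs] at hsim
      exact ih _ _ _ hsim
    · rw [hs] at hsim
      simp only [true_iff]
      rw [iterate_of_ne (by rw [hsim]; simp)]
      exact hsim
    · rw [hs] at hsim
      simp only [Bool.false_eq_true, false_iff]
      rw [iterate_of_ne (by rw [hsim]; simp), hsim]
      simp

/-- **The machine's verdict on a closed term, in first-order form.** [cite: GaboardiMarionRonchidellarocca2008, Thm. 5.12] -/
theorem run_init_iff (T : Term) (n : ℕ) (o : List Bool) :
    KAM.run n o (KAM.init T) = true ↔ ((istep (tags T) (argA T) (argB T))^[n] (iinit o)).st = 1 :=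
  run_iff_iterate T n _ _ _ (sim_init T o)

end KAMi

end STA

end Literature.Computability.ImplicitComplexity

-- ============================== Part: MachineFP ==============================

/-!
## Part `MachineFP`: A sharing abstract machine for `STA₊`, VIII: one transition is polynomial time

GMR08 (= Gaboardi–Marion–Ronchi Della Rocca 2008) Thm. 5.12 asserts that the machine `K_ND`
evaluates typed terms "by a non deterministic Turing machine in time `O(|M|^{O(d(Π))})`"; on the
tree's side this is membership of the (oracle-driven, deterministic) machine's run in the class
`FP` of polynomial-time string functions over Mathlib's `FinTM2` machines. This file performs the
first step: the first-order transition `STA.KAMi.istep` — a fixed composition of table look-ups,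
list operations and comparisons — is a polynomial-time map on codes, in the sense of the tree's
typed toolkit `CodeFP` (`Literature/Computability/Complexity/CodeFP.lean`):

* `STA.KAMi.Tbl`, `STA.KAMi.Tup`, `tblE`, `tupE` — the node table and the state as nested pairs of
  numerals / raw lists, with their codes;
* `STA.KAMi.istepT` — the transition written on tuples with Boolean tests, `istepT_fp` its
  `CodeFP` realisation, and `istepT_tup` its agreement with `KAMi.istep`.

## References

* [GaboardiMarionRonchidellarocca2008] GMR08, Thm. 5.12.
* [AroraBarak2009] S. Arora, B. Barak, *Computational Complexity*, §1.3 (closure properties of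
  polynomial time used by `CodeFP`).
-/

namespace Literature.Computability.ImplicitComplexity

namespace STA

namespace KAMi

open Literature.Computability.Complexity Literature.Computability.Complexity.CodeFP

/-- Node tables: the three columns. [folklore] -/
abbrev Tbl : Type := List ℕ × (List ℕ × List ℕ)

/-- States as nested pairs. [folklore] -/
abbrev Tup : Type := ℕ × (List ℕ × (List (List ℕ) × (List (List ℕ) × (ℕ × (List ℕ × ℕ)))))

/-- Code of a node table. [folklore] -/
abbrev tblE : Tbl → List Bool := pairE (rawE natE) (pairE (rawE natE) (rawE natE))

/-- Code of a state. [folklore] -/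
abbrev tupE : Tup → List Bool :=
  pairE natE (pairE (rawE natE) (pairE (rawE (rawE natE)) (pairE (rawE (rawE natE))
    (pairE natE (pairE (rawE natE) natE)))))

/-- A state as a tuple. [folklore] -/
def IState.tup (s : IState) : Tup := (s.code, s.env, s.stk, s.hp, s.depth, s.orc, s.st)

/-- A tuple as a state. [folklore] -/
def IState.ofTup (x : Tup) : IState := ⟨x.1, x.2.1, x.2.2.1, x.2.2.2.1, x.2.2.2.2.1, x.2.2.2.2.2.1, x.2.2.2.2.2.2⟩

/-- Round trip. [folklore] -/
@[simp] theorem IState.ofTup_tup (s : IState) : IState.ofTup s.tup = s := by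
  cases s; rfl

/-- Round trip. [folklore] -/
@[simp] theorem IState.tup_ofTup (x : Tup) : (IState.ofTup x).tup = x := rfl

/-- The code of a state. [folklore] -/
def encI : IState → List Bool := fun s => tupE s.tup

/-- **The transition on tuples**, with Boolean tests (the form realised on codes).
[cite: GaboardiMarionRonchidellarocca2008, Table 6] -/
def istepT (p : Tbl × Tup) : Tup :=
  if decide (p.2.2.2.2.2.2.2 = 0) then
    if decide (p.1.1.getD p.2.1 0 = 1) then
      (p.1.2.1.getD p.2.1 0, p.2.2.1, (p.1.2.2.getD p.2.1 0 :: p.2.2.1) :: p.2.2.2.1, p.2.2.2.2.1,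
        p.2.2.2.2.2.1, p.2.2.2.2.2.2.1, 0)
    else if decide (p.1.1.getD p.2.1 0 = 2) then
      if p.2.2.2.1.isEmpty then
        if decide (p.2.2.2.2.2.1 < 2) then
          (p.1.2.1.getD p.2.1 0, p.2.2.2.2.1.length :: p.2.2.1, p.2.2.2.1, p.2.2.2.2.1 ++ [1 :: p.2.2.2.2.2.1 :: []],
            p.2.2.2.2.2.1 + 1, p.2.2.2.2.2.2.1, 0)
        else (p.2.1, p.2.2.1, p.2.2.2.1, p.2.2.2.2.1, p.2.2.2.2.2.1, p.2.2.2.2.2.2.1, 2)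
      else
        (p.1.2.1.getD p.2.1 0, p.2.2.2.2.1.length :: p.2.2.1, p.2.2.2.1.tail,
          p.2.2.2.2.1 ++ [0 :: p.2.2.2.1.headD []], p.2.2.2.2.2.1, p.2.2.2.2.2.2.1, 0)
    else if decide (p.1.1.getD p.2.1 0 = 3) then
      if p.2.2.2.2.2.2.1.isEmpty then (p.2.1, p.2.2.1, p.2.2.2.1, p.2.2.2.2.1, p.2.2.2.2.2.1, p.2.2.2.2.2.2.1, 2)
      else
        ((if decide (p.2.2.2.2.2.2.1.headD 0 = 1) then p.1.2.2.getD p.2.1 0 else p.1.2.1.getD p.2.1 0),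
          p.2.2.1, p.2.2.2.1, p.2.2.2.2.1, p.2.2.2.2.2.1, p.2.2.2.2.2.2.1.tail, 0)
    else
      if decide (p.1.2.1.getD p.2.1 0 < p.2.2.1.length) then
        if decide (p.2.2.1.getD (p.1.2.1.getD p.2.1 0) 0 < p.2.2.2.2.1.length) then
          if decide ((p.2.2.2.2.1.getD (p.2.2.1.getD (p.1.2.1.getD p.2.1 0) 0) []).headD 0 = 0) then
            ((p.2.2.2.2.1.getD (p.2.2.1.getD (p.1.2.1.getD p.2.1 0) 0) []).tail.headD 0,
              (p.2.2.2.2.1.getD (p.2.2.1.getD (p.1.2.1.getD p.2.1 0) 0) []).tail.tail,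
              p.2.2.2.1, p.2.2.2.2.1, p.2.2.2.2.2.1, p.2.2.2.2.2.2.1, 0)
          else if p.2.2.2.1.isEmpty && (decide (p.2.2.2.2.2.1 = 2) &&
              decide ((p.2.2.2.2.1.getD (p.2.2.1.getD (p.1.2.1.getD p.2.1 0) 0) []).tail.headD 0 = 0)) then
            (p.2.1, p.2.2.1, p.2.2.2.1, p.2.2.2.2.1, p.2.2.2.2.2.1, p.2.2.2.2.2.2.1, 1)
          else (p.2.1, p.2.2.1, p.2.2.2.1, p.2.2.2.2.1, p.2.2.2.2.2.1, p.2.2.2.2.2.2.1, 2)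
        else (p.2.1, p.2.2.1, p.2.2.2.1, p.2.2.2.2.1, p.2.2.2.2.2.1, p.2.2.2.2.2.2.1, 2)
      else (p.2.1, p.2.2.1, p.2.2.2.1, p.2.2.2.2.1, p.2.2.2.2.2.1, p.2.2.2.2.2.2.1, 2)
  else p.2

/-- **The transition is polynomial time on codes.** [cite: GaboardiMarionRonchidellarocca2008, Thm. 5.12] -/
theorem istepT_fp : CodeFP (pairE tblE tupE) tupE istepT := by
  -- projections of the input `(table, state)`
  have hTg : CodeFP (pairE tblE tupE) (rawE natE) (fun p => p.1.1) := (fst _ _).fst'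
  have hNa : CodeFP (pairE tblE tupE) (rawE natE) (fun p => p.1.2.1) := (fst _ _).snd'.fst'
  have hNb : CodeFP (pairE tblE tupE) (rawE natE) (fun p => p.1.2.2) := (fst _ _).snd'.snd'
  have hS : CodeFP (pairE tblE tupE) tupE (fun p => p.2) := snd _ _
  have hCode : CodeFP (pairE tblE tupE) natE (fun p => p.2.1) := hS.fst'
  have hEnv : CodeFP (pairE tblE tupE) (rawE natE) (fun p => p.2.2.1) := hS.snd'.fst'
  have hStk : CodeFP (pairE tblE tupE) (rawE (rawE natE)) (fun p => p.2.2.2.1) := hS.snd'.snd'.fst'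
  have hHp : CodeFP (pairE tblE tupE) (rawE (rawE natE)) (fun p => p.2.2.2.2.1) := hS.snd'.snd'.snd'.fst'
  have hDepth : CodeFP (pairE tblE tupE) natE (fun p => p.2.2.2.2.2.1) := hS.snd'.snd'.snd'.snd'.fst'
  have hOrc : CodeFP (pairE tblE tupE) (rawE natE) (fun p => p.2.2.2.2.2.2.1) := hS.snd'.snd'.snd'.snd'.snd'.fst'
  have hSt : CodeFP (pairE tblE tupE) natE (fun p => p.2.2.2.2.2.2.2) := hS.snd'.snd'.snd'.snd'.snd'.snd'
  -- table look-ups at the code position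
  have hTag : CodeFP (pairE tblE tupE) natE (fun p => p.1.1.getD p.2.1 0) := (rawGetD natE rfl).comp (hTg.pair hCode)
  have hA : CodeFP (pairE tblE tupE) natE (fun p => p.1.2.1.getD p.2.1 0) := (rawGetD natE rfl).comp (hNa.pair hCode)
  have hB : CodeFP (pairE tblE tupE) natE (fun p => p.1.2.2.getD p.2.1 0) := (rawGetD natE rfl).comp (hNb.pair hCode)
  -- tests
  have hIsSt0 : CodeFP (pairE tblE tupE) bitE (fun p => decide (p.2.2.2.2.2.2.2 = 0)) := natEq.comp (hSt.pair (const _ 0))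
  have hTag1 : CodeFP (pairE tblE tupE) bitE (fun p => decide (p.1.1.getD p.2.1 0 = 1)) := natEq.comp (hTag.pair (const _ 1))
  have hTag2 : CodeFP (pairE tblE tupE) bitE (fun p => decide (p.1.1.getD p.2.1 0 = 2)) := natEq.comp (hTag.pair (const _ 2))
  have hTag3 : CodeFP (pairE tblE tupE) bitE (fun p => decide (p.1.1.getD p.2.1 0 = 3)) := natEq.comp (hTag.pair (const _ 3))
  have hStkEmpty : CodeFP (pairE tblE tupE) bitE (fun p => p.2.2.2.1.isEmpty) := (rawIsEmpty _).comp hStk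
  have hDepthLt2 : CodeFP (pairE tblE tupE) bitE (fun p => decide (p.2.2.2.2.2.1 < 2)) := natLt.comp (hDepth.pair (const _ 2))
  have hOrcEmpty : CodeFP (pairE tblE tupE) bitE (fun p => p.2.2.2.2.2.2.1.isEmpty) := (rawIsEmpty _).comp hOrc
  have hHpLen : CodeFP (pairE tblE tupE) natE (fun p => p.2.2.2.2.1.length) := (natLength _).comp hHp
  have hEnvLen : CodeFP (pairE tblE tupE) natE (fun p => p.2.2.1.length) := (natLength _).comp hEnv
  have hALtEnv : CodeFP (pairE tblE tupE) bitE (fun p => decide (p.1.2.1.getD p.2.1 0 < p.2.2.1.length)) :=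
    natLt.comp (hA.pair hEnvLen)
  have hPtr : CodeFP (pairE tblE tupE) natE (fun p => p.2.2.1.getD (p.1.2.1.getD p.2.1 0) 0) :=
    (rawGetD natE rfl).comp (hEnv.pair hA)
  have hPtrLt : CodeFP (pairE tblE tupE) bitE
      (fun p => decide (p.2.2.1.getD (p.1.2.1.getD p.2.1 0) 0 < p.2.2.2.2.1.length)) := natLt.comp (hPtr.pair hHpLen)
  have hCell : CodeFP (pairE tblE tupE) (rawE natE) (fun p => p.2.2.2.2.1.getD (p.2.2.1.getD (p.1.2.1.getD p.2.1 0) 0) []) :=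
    (rawGetD (rawE natE) rfl).comp (hHp.pair hPtr)
  have hCellHead : CodeFP (pairE tblE tupE) natE
      (fun p => (p.2.2.2.2.1.getD (p.2.2.1.getD (p.1.2.1.getD p.2.1 0) 0) []).headD 0) := (rawHeadD natE rfl).comp hCell
  have hCellHead0 : CodeFP (pairE tblE tupE) bitE
      (fun p => decide ((p.2.2.2.2.1.getD (p.2.2.1.getD (p.1.2.1.getD p.2.1 0) 0) []).headD 0 = 0)) :=
    natEq.comp (hCellHead.pair (const _ 0))
  have hCellTail : CodeFP (pairE tblE tupE) (rawE natE)
      (fun p => (p.2.2.2.2.1.getD (p.2.2.1.getD (p.1.2.1.getD p.2.1 0) 0) []).tail) := (rawTail natE).comp hCell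
  have hCellTH : CodeFP (pairE tblE tupE) natE
      (fun p => (p.2.2.2.2.1.getD (p.2.2.1.getD (p.1.2.1.getD p.2.1 0) 0) []).tail.headD 0) := (rawHeadD natE rfl).comp hCellTail
  have hCellTT : CodeFP (pairE tblE tupE) (rawE natE)
      (fun p => (p.2.2.2.2.1.getD (p.2.2.1.getD (p.1.2.1.getD p.2.1 0) 0) []).tail.tail) := (rawTail natE).comp hCellTail
  have hCellTH0 : CodeFP (pairE tblE tupE) bitE
      (fun p => decide ((p.2.2.2.2.1.getD (p.2.2.1.getD (p.1.2.1.getD p.2.1 0) 0) []).tail.headD 0 = 0)) :=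
    natEq.comp (hCellTH.pair (const _ 0))
  have hOrcHead1 : CodeFP (pairE tblE tupE) bitE (fun p => decide (p.2.2.2.2.2.2.1.headD 0 = 1)) :=
    natEq.comp (((rawHeadD natE rfl).comp hOrc).pair (const _ 1))
  have hOrcTail : CodeFP (pairE tblE tupE) (rawE natE) (fun p => p.2.2.2.2.2.2.1.tail) := (rawTail natE).comp hOrc
  have hStkHead : CodeFP (pairE tblE tupE) (rawE natE) (fun p => p.2.2.2.1.headD []) := (rawHeadD (rawE natE) rfl).comp hStk
  have hStkTail : CodeFP (pairE tblE tupE) (rawE (rawE natE)) (fun p => p.2.2.2.1.tail) := (rawTail _).comp hStk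
  have hDepth2 : CodeFP (pairE tblE tupE) bitE (fun p => decide (p.2.2.2.2.2.1 = 2)) := natEq.comp (hDepth.pair (const _ 2))
  have hAccCond : CodeFP (pairE tblE tupE) bitE (fun p => p.2.2.2.1.isEmpty && (decide (p.2.2.2.2.2.1 = 2) &&
      decide ((p.2.2.2.2.1.getD (p.2.2.1.getD (p.1.2.1.getD p.2.1 0) 0) []).tail.headD 0 = 0))) :=
    hStkEmpty.and (hDepth2.and hCellTH0)
  -- the new states of the branches
  have hZero : CodeFP (pairE tblE tupE) natE (fun _ => (0 : ℕ)) := const _ 0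
  have hOne : CodeFP (pairE tblE tupE) natE (fun _ => (1 : ℕ)) := const _ 1
  have hTwo : CodeFP (pairE tblE tupE) natE (fun _ => (2 : ℕ)) := const _ 2
  have outApp : CodeFP (pairE tblE tupE) tupE (fun p => (p.1.2.1.getD p.2.1 0, p.2.2.1,
      (p.1.2.2.getD p.2.1 0 :: p.2.2.1) :: p.2.2.2.1, p.2.2.2.2.1, p.2.2.2.2.2.1, p.2.2.2.2.2.2.1, (0 : ℕ))) :=
    hA.pair (hEnv.pair ((((rawCons (rawE natE)).comp (((rawCons natE).comp (hB.pair hEnv)).pair hStk)).pair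
      (hHp.pair (hDepth.pair (hOrc.pair hZero))))))
  have outEnter : CodeFP (pairE tblE tupE) tupE (fun p => (p.1.2.1.getD p.2.1 0, p.2.2.2.2.1.length :: p.2.2.1,
      p.2.2.2.1, p.2.2.2.2.1 ++ [1 :: p.2.2.2.2.2.1 :: []], p.2.2.2.2.2.1 + 1, p.2.2.2.2.2.2.1, (0 : ℕ))) :=
    hA.pair (((rawCons natE).comp (hHpLen.pair hEnv)).pair (hStk.pair
      (((rawAppend _).comp (hHp.pair ((rawSingleton _).comp ((rawCons natE).comp (hOne.pair
        ((rawCons natE).comp (hDepth.pair (const _ ([] : List ℕ))))))))).pair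
      ((natAdd.comp (hDepth.pair hOne)).pair (hOrc.pair hZero)))))
  have outBeta : CodeFP (pairE tblE tupE) tupE (fun p => (p.1.2.1.getD p.2.1 0, p.2.2.2.2.1.length :: p.2.2.1,
      p.2.2.2.1.tail, p.2.2.2.2.1 ++ [0 :: p.2.2.2.1.headD []], p.2.2.2.2.2.1, p.2.2.2.2.2.2.1, (0 : ℕ))) :=
    hA.pair (((rawCons natE).comp (hHpLen.pair hEnv)).pair (hStkTail.pair
      (((rawAppend _).comp (hHp.pair ((rawSingleton _).comp ((rawCons natE).comp (hZero.pair hStkHead))))).pair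
      (hDepth.pair (hOrc.pair hZero)))))
  have outHalt : ∀ v : ℕ, CodeFP (pairE tblE tupE) tupE (fun p => (p.2.1, p.2.2.1, p.2.2.2.1, p.2.2.2.2.1,
      p.2.2.2.2.2.1, p.2.2.2.2.2.2.1, v)) := fun v =>
    hCode.pair (hEnv.pair (hStk.pair (hHp.pair (hDepth.pair (hOrc.pair (const _ v))))))
  have outSum : CodeFP (pairE tblE tupE) tupE (fun p =>
      ((if decide (p.2.2.2.2.2.2.1.headD 0 = 1) then p.1.2.2.getD p.2.1 0 else p.1.2.1.getD p.2.1 0),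
        p.2.2.1, p.2.2.2.1, p.2.2.2.2.1, p.2.2.2.2.2.1, p.2.2.2.2.2.2.1.tail, (0 : ℕ))) :=
    (hOrcHead1.ite hB hA).pair (hEnv.pair (hStk.pair (hHp.pair (hDepth.pair (hOrcTail.pair hZero)))))
  have outVar : CodeFP (pairE tblE tupE) tupE (fun p =>
      ((p.2.2.2.2.1.getD (p.2.2.1.getD (p.1.2.1.getD p.2.1 0) 0) []).tail.headD 0,
        (p.2.2.2.2.1.getD (p.2.2.1.getD (p.1.2.1.getD p.2.1 0) 0) []).tail.tail,
        p.2.2.2.1, p.2.2.2.2.1, p.2.2.2.2.2.1, p.2.2.2.2.2.2.1, (0 : ℕ))) :=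
    hCellTH.pair (hCellTT.pair (hStk.pair (hHp.pair (hDepth.pair (hOrc.pair hZero)))))
  -- assembling the branches
  have varBranch := hALtEnv.ite (hPtrLt.ite (hCellHead0.ite outVar (hAccCond.ite (outHalt 1) (outHalt 2)))
    (outHalt 2)) (outHalt 2)
  have lamBranch := hStkEmpty.ite (hDepthLt2.ite outEnter (outHalt 2)) outBeta
  have sumBranch := hOrcEmpty.ite (outHalt 2) outSum
  have body := hTag1.ite outApp (hTag2.ite lamBranch (hTag3.ite sumBranch varBranch))
  exact (hIsSt0.ite body hS).congr fun p => rfl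

/-- **The tuple transition is the first-order transition.** [folklore] -/
theorem istepT_tup (tbl : Tbl) (s : IState) : istepT (tbl, s.tup) = (istep tbl.1 tbl.2.1 tbl.2.2 s).tup := by
  obtain ⟨tg, na, nb⟩ := tbl
  obtain ⟨c, env, stk, hp, d, orc, st⟩ := s
  simp only [istepT, IState.tup, istep, decide_eq_true_eq, Bool.and_eq_true]
  split_ifs <;> rfl

/-- Iterating the tuple transition is iterating the first-order transition. [folklore] -/
theorem istepT_iterate (tbl : Tbl) (s : IState) (n : ℕ) :
    (fun x => istepT (tbl, x))^[n] s.tup = ((istep tbl.1 tbl.2.1 tbl.2.2)^[n] s).tup := by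
  induction n generalizing s with
  | zero => rfl
  | succ n ih => rw [Function.iterate_succ_apply, Function.iterate_succ_apply, istepT_tup, ih]

end KAMi

end STA

end Literature.Computability.ImplicitComplexity

-- ============================== Part: MachineFPRun ==============================

/-!
## Part `MachineFPRun`: A sharing abstract machine for `STA₊`, IX: a whole run is polynomial time

Continuation of Part `MachineFP` of this file (GMR08 = Gaboardi–Marion–Ronchi Della Rocca 2008,
Thm. 5.12: the machine evaluates in polynomial time; here on the tree's `FinTM2` classes via the
typed toolkit `CodeFP`). Iterating the transition `KAMi.istepT` over a unary fuel list is a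
`CodeFP.foldl`; its one hypothesis is that the CODE of the state stays polynomially bounded along
the run — the polynomial SPACE bound of GMR08 Lemma 5.10/5.11: here every number of a reachable
state is either copied from the table or the oracle, or a heap pointer below the number of steps,
and every list has length at most the initial oracle length plus the number of steps. Contents:

* `KAMi.SmallList`, `KAMi.Inv` — the size invariant, preserved by a transition (`Inv.step`) and
  bounding the state's code (`length_tupE_le`);
* `KAMi.runT_fp` — `((table, oracle), fuel) ↦ istepT^{|fuel|} (initial state)` is polynomial
  time on codes.

## References

* [GaboardiMarionRonchidellarocca2008] GMR08, Lemma 5.10, Lemma 5.11, Thm. 5.12.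
* [AroraBarak2009] §1.3 (polynomially bounded loops).
-/

namespace Literature.Computability.ImplicitComplexity

namespace STA

namespace KAMi

open Literature.Computability.Complexity Literature.Computability.Complexity.CodeFP Polynomial

/-! ### The size invariant -/

/-- A list of numbers with at most `L` items, each of code length `≤ K`. [folklore] -/
def SmallList (K L : ℕ) (l : List ℕ) : Prop := l.length ≤ L ∧ ∀ n ∈ l, (natE n).length ≤ K

/-- A list of small lists. [folklore] -/
def SmallLL (K L : ℕ) (ll : List (List ℕ)) : Prop := ll.length ≤ L ∧ ∀ it ∈ ll, SmallList K L it

/-- The size invariant of a state. [folklore] -/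
structure Inv (K L : ℕ) (x : Tup) : Prop where
  /-- the code position is small -/
  code : (natE x.1).length ≤ K
  /-- the environment is small -/
  env : SmallList K L x.2.1
  /-- the stack is small -/
  stk : SmallLL K L x.2.2.1
  /-- the heap is small -/
  hp : SmallLL K L x.2.2.2.1
  /-- the depth is small -/
  depth : (natE x.2.2.2.2.1).length ≤ K
  /-- the oracle is small -/
  orc : SmallList K L x.2.2.2.2.2.1
  /-- the status is small -/
  st : (natE x.2.2.2.2.2.2).length ≤ K

/-- A table all of whose argument entries have code length `≤ K`. [folklore] -/
def TblOK (K : ℕ) (tbl : Tbl) : Prop := (∀ n ∈ tbl.2.1, (natE n).length ≤ K) ∧ ∀ n ∈ tbl.2.2, (natE n).length ≤ K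

namespace SmallList

variable {K L : ℕ}

/-- Monotonicity in the length bound. [folklore] -/
theorem mono {l : List ℕ} (h : SmallList K L l) {L' : ℕ} (hL : L ≤ L') : SmallList K L' l := ⟨h.1.trans hL, h.2⟩

/-- The empty list. [folklore] -/
theorem nil : SmallList K L [] := ⟨Nat.zero_le _, by simp⟩

/-- Cons. [folklore] -/
theorem cons {l : List ℕ} (h : SmallList K L l) {n : ℕ} (hn : (natE n).length ≤ K) : SmallList K (L + 1) (n :: l) :=
  ⟨by simp [h.1], fun m hm => by rcases List.mem_cons.1 hm with rfl | hm; exacts [hn, h.2 m hm]⟩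

/-- Tail. [folklore] -/
theorem tail {l : List ℕ} (h : SmallList K L l) : SmallList K L l.tail :=
  ⟨by rw [List.length_tail]; have := h.1; omega, fun m hm => h.2 m (List.mem_of_mem_tail hm)⟩

/-- Items (with default `0`). [folklore] -/
theorem headD {l : List ℕ} (h : SmallList K L l) : (natE (l.headD 0)).length ≤ K := by
  cases l with
  | nil => simp
  | cons a l => exact h.2 a (by simp)

/-- Items (with default `0`). [folklore] -/
theorem getD {l : List ℕ} (h : SmallList K L l) (i : ℕ) : (natE (l.getD i 0)).length ≤ K := by
  rw [List.getD_eq_getElem?_getD]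
  cases hg : l[i]? with
  | none => simp
  | some a => exact h.2 a (List.mem_of_getElem? hg)

/-- Code length of a small list. [folklore] -/
theorem length_rawE_le {l : List ℕ} (h : SmallList K L l) : (rawE natE l).length ≤ L * (2 * K + 2) := by
  rw [CodeFP.length_rawE]
  calc (l.map fun a => 2 * (natE a).length + 2).sum ≤ (l.map fun _ => 2 * K + 2).sum :=
        List.sum_le_sum (fun a ha => by have := h.2 a ha; omega)
    _ = l.length * (2 * K + 2) := by rw [List.map_const', List.sum_replicate, smul_eq_mul]
    _ ≤ L * (2 * K + 2) := Nat.mul_le_mul_right _ h.1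

end SmallList

namespace SmallLL

variable {K L : ℕ}

/-- Monotonicity in the length bound. [folklore] -/
theorem mono {ll : List (List ℕ)} (h : SmallLL K L ll) {L' : ℕ} (hL : L ≤ L') : SmallLL K L' ll :=
  ⟨h.1.trans hL, fun it hit => (h.2 it hit).mono hL⟩

/-- The empty list. [folklore] -/
theorem nil : SmallLL K L [] := ⟨Nat.zero_le _, by simp⟩

/-- Cons. [folklore] -/
theorem cons {ll : List (List ℕ)} (h : SmallLL K L ll) {it : List ℕ} (hit : SmallList K (L + 1) it) :
    SmallLL K (L + 1) (it :: ll) :=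
  ⟨by simp [h.1], fun x hx => by rcases List.mem_cons.1 hx with rfl | hx; exacts [hit, (h.2 x hx).mono (Nat.le_succ L)]⟩

/-- Snoc. [folklore] -/
theorem snoc {ll : List (List ℕ)} (h : SmallLL K L ll) {it : List ℕ} (hit : SmallList K (L + 1) it) :
    SmallLL K (L + 1) (ll ++ [it]) :=
  ⟨by simp [h.1], fun x hx => by
    rcases List.mem_append.1 hx with hx | hx
    · exact (h.2 x hx).mono (Nat.le_succ L)
    · rw [List.mem_singleton] at hx; subst hx; exact hit⟩

/-- Tail. [folklore] -/
theorem tail {ll : List (List ℕ)} (h : SmallLL K L ll) : SmallLL K L ll.tail :=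
  ⟨by rw [List.length_tail]; have := h.1; omega, fun x hx => h.2 x (List.mem_of_mem_tail hx)⟩

/-- Items (default `[]`). [folklore] -/
theorem headD {ll : List (List ℕ)} (h : SmallLL K L ll) : SmallList K L (ll.headD []) := by
  cases ll with
  | nil => exact SmallList.nil
  | cons a l => exact h.2 a (by simp)

/-- Items (default `[]`). [folklore] -/
theorem getD {ll : List (List ℕ)} (h : SmallLL K L ll) (i : ℕ) : SmallList K L (ll.getD i []) := by
  rw [List.getD_eq_getElem?_getD]
  cases hg : ll[i]? with
  | none => exact SmallList.nil
  | some a => exact h.2 a (List.mem_of_getElem? hg)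

/-- Code length of a small list of lists. [folklore] -/
theorem length_rawE_le {ll : List (List ℕ)} (h : SmallLL K L ll) :
    (rawE (rawE natE) ll).length ≤ L * (2 * (L * (2 * K + 2)) + 2) := by
  rw [CodeFP.length_rawE]
  calc (ll.map fun a => 2 * (rawE natE a).length + 2).sum ≤ (ll.map fun _ => 2 * (L * (2 * K + 2)) + 2).sum :=
        List.sum_le_sum (fun a ha => by have := (h.2 a ha).length_rawE_le; omega)
    _ = ll.length * (2 * (L * (2 * K + 2)) + 2) := by rw [List.map_const', List.sum_replicate, smul_eq_mul]
    _ ≤ L * (2 * (L * (2 * K + 2)) + 2) := Nat.mul_le_mul_right _ h.1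

end SmallLL

/-- Code lengths of numerals are monotone. [folklore] -/
theorem length_natE_mono {a b : ℕ} (h : a ≤ b) : (natE a).length ≤ (natE b).length := by
  rw [CodeFP.length_natE, CodeFP.length_natE]
  exact Nat.size_le_size h

/-- `|natE 2| = 2`. [folklore] -/
theorem length_natE_two : (natE 2).length = 2 := by decide

namespace Inv

variable {K L : ℕ} {tbl : Tbl} {x : Tup}

/-- **The transition preserves the size invariant** (lengths grow by one, number sizes stay),
for `K ≥ |natE L|, 2` and `L ≥ 1`. [cite: GaboardiMarionRonchidellarocca2008, Lemma 5.10] -/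
theorem step (h : Inv K L x) (ht : TblOK K tbl) (hKL : (natE L).length ≤ K) (hK2 : 2 ≤ K) (hL1 : 1 ≤ L) :
    Inv K (L + 1) (istepT (tbl, x)) := by
  obtain ⟨tg, na, nb⟩ := tbl
  obtain ⟨c, env, stk, hp, d, orc, st⟩ := x
  obtain ⟨hc, henv, hstk, hhp, hd, horc, hst⟩ := h
  dsimp only at hc henv hstk hhp hd horc hst
  have hA : (natE (na.getD c 0)).length ≤ K := SmallList.getD (K := K) (L := na.length) ⟨le_rfl, ht.1⟩ c
  have hB : (natE (nb.getD c 0)).length ≤ K := SmallList.getD (K := K) (L := nb.length) ⟨le_rfl, ht.2⟩ c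
  have h0 : (natE 0).length ≤ K := by simp
  have h1 : (natE 1).length ≤ K := le_trans (by decide) hK2
  have h2 : (natE 2).length ≤ K := le_trans (by decide) hK2
  have hHpLen : (natE hp.length).length ≤ K := (length_natE_mono hhp.1).trans hKL
  have hcell : SmallList K L (hp.getD (env.getD (na.getD c 0) 0) []) := hhp.getD _
  have same : Inv K (L + 1) (c, env, stk, hp, d, orc, st) :=
    ⟨hc, henv.mono (Nat.le_succ L), hstk.mono (Nat.le_succ L), hhp.mono (Nat.le_succ L), hd, horc.mono (Nat.le_succ L), hst⟩
  have halt : ∀ v, (natE v).length ≤ K → Inv K (L + 1) (c, env, stk, hp, d, orc, v) := fun v hv =>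
    ⟨hc, henv.mono (Nat.le_succ L), hstk.mono (Nat.le_succ L), hhp.mono (Nat.le_succ L), hd, horc.mono (Nat.le_succ L), hv⟩
  have hcell1 : SmallList K (L + 1) [1, d] := ⟨by show 2 ≤ L + 1; omega, fun m hm => by
    simp only [List.mem_cons, List.not_mem_nil, or_false] at hm
    rcases hm with rfl | rfl
    · exact h1
    · exact hd⟩
  simp only [istepT]
  split_ifs <;> first
    | exact same
    | exact halt 2 h2
    | exact halt 1 h1
    | exact ⟨hA, henv.mono (Nat.le_succ L), hstk.cons (henv.cons hB), hhp.mono (Nat.le_succ L), hd,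
        horc.mono (Nat.le_succ L), h0⟩
    | exact ⟨hA, henv.cons hHpLen, hstk.mono (Nat.le_succ L), hhp.snoc hcell1,
        (length_natE_mono (show d + 1 ≤ 2 by
          have hlt : d < 2 := by simpa using ‹decide (d < 2) = true›
          omega)).trans h2, horc.mono (Nat.le_succ L), h0⟩
    | exact ⟨hA, henv.cons hHpLen, hstk.tail.mono (Nat.le_succ L), hhp.snoc ((hstk.headD).cons h0), hd,
        horc.mono (Nat.le_succ L), h0⟩
    | exact ⟨hB, henv.mono (Nat.le_succ L), hstk.mono (Nat.le_succ L), hhp.mono (Nat.le_succ L), hd,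
        horc.tail.mono (Nat.le_succ L), h0⟩
    | exact ⟨hA, henv.mono (Nat.le_succ L), hstk.mono (Nat.le_succ L), hhp.mono (Nat.le_succ L), hd,
        horc.tail.mono (Nat.le_succ L), h0⟩
    | exact ⟨hcell.tail.headD, hcell.tail.tail.mono (Nat.le_succ L), hstk.mono (Nat.le_succ L), hhp.mono (Nat.le_succ L), hd,
        horc.mono (Nat.le_succ L), h0⟩

/-- Iterating the transition from a state satisfying the invariant. [folklore] -/
theorem iterate (ht : TblOK K tbl) (hK2 : 2 ≤ K) : ∀ (j : ℕ) {L : ℕ} {x : Tup}, Inv K L x → 1 ≤ L → (natE (L + j)).length ≤ K →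
    Inv K (L + j) ((fun y => istepT (tbl, y))^[j] x)
  | 0, L, x, h, _, _ => h
  | j + 1, L, x, h, hL1, hKL => by
    rw [Function.iterate_succ_apply, show L + (j + 1) = (L + 1) + j by omega]
    refine iterate ht hK2 j (h.step ht ((length_natE_mono (by omega)).trans hKL) hK2 hL1) (by omega) ?_
    rwa [show L + 1 + j = L + (j + 1) by omega]

/-- **The code of a state satisfying the invariant is polynomially bounded.**
[cite: GaboardiMarionRonchidellarocca2008, Lemma 5.11] -/
theorem length_tupE_le (h : Inv K L x) : (tupE x).length ≤ 20 * ((L + 1) * (L + 1) * (K + 1)) := by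
  obtain ⟨c, env, stk, hp, d, orc, st⟩ := x
  obtain ⟨hc, henv, hstk, hhp, hd, horc, hst⟩ := h
  dsimp only at hc henv hstk hhp hd horc hst
  have e1 := henv.length_rawE_le
  have e2 := hstk.length_rawE_le
  have e3 := hhp.length_rawE_le
  have e4 := horc.length_rawE_le
  simp only [tupE, pairE_apply, length_boolPair]
  have hLK : L * (2 * K + 2) ≤ 2 * ((L + 1) * (L + 1) * (K + 1)) := by nlinarith
  have hLLK : L * (2 * (L * (2 * K + 2)) + 2) ≤ 4 * ((L + 1) * (L + 1) * (K + 1)) := by nlinarith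
  have hK : K ≤ (L + 1) * (L + 1) * (K + 1) := by nlinarith
  nlinarith

end Inv

/-! ### The run -/

/-- The initial state on tuples, for an oracle already in `0`/`1` form. [folklore] -/
def initT (o : List ℕ) : Tup := (0, [], [], [], 0, o, 0)

/-- The initial first-order state, as a tuple. [folklore] -/
theorem iinit_tup (o : List Bool) : (iinit o).tup = initT (o.map bitNat) := rfl

/-- A fold with a step ignoring the item is an iteration. [folklore] -/
theorem foldl_const_eq_iterate {β γ : Type} (f : β → β) (b : β) (l : List γ) :
    l.foldl (fun acc _ => f acc) b = f^[l.length] b := by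
  induction l generalizing b with
  | nil => rfl
  | cons a l ih => rw [List.foldl_cons, ih, List.length_cons, Function.iterate_succ_apply]

/-- Items of the oracle are short. [folklore] -/
theorem smallList_of_rawE (o : List ℕ) : SmallList (rawE natE o).length (rawE natE o).length o :=
  ⟨CodeFP.length_le_length_rawE natE o, fun n hn => by
    have := CodeFP.length_item_le_length_rawE natE hn; omega⟩

/-- **A run of the machine is polynomial time on codes**: `((table, oracle), fuel) ↦` the state after
`|fuel|` transitions from the initial state. [cite: GaboardiMarionRonchidellarocca2008, Thm. 5.12] -/
theorem runT_fp : CodeFP (pairE (pairE tblE (rawE natE)) (rawE unitE)) tupE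
    (fun p => (fun x => istepT (p.1.1, x))^[p.2.length] (initT p.1.2)) := by
  have hstep : CodeFP (pairE (pairE tblE (rawE natE)) (pairE unitE tupE)) tupE (fun t => istepT (t.1.1, t.2.2)) :=
    istepT_fp.comp ((fst _ _).fst'.pair (snd _ _).snd')
  have hinit : CodeFP (pairE tblE (rawE natE)) tupE (fun s => initT s.2) :=
    (const _ (0 : ℕ)).pair ((const _ ([] : List ℕ)).pair ((const _ ([] : List (List ℕ))).pair
      ((const _ ([] : List (List ℕ))).pair ((const _ (0 : ℕ)).pair ((snd _ _).pair (const _ (0 : ℕ)))))))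
  have h := foldl (σ := Tbl × List ℕ) (α := Unit) (β := Tup) (eσ := pairE tblE (rawE natE)) (eα := unitE) (eβ := tupE)
    (step := fun s _ b => istepT (s.1, b)) (init := fun s => initT s.2) hstep hinit
    (C 20 * ((C 2 * X + C 1) * (C 2 * X + C 1) * (C 2 * X + C 1))) (fun s l₁ l₂ => ?_)
  · exact h.congr fun p => by rw [foldl_const_eq_iterate]
  -- the polynomial bound on the state's code along the run
  obtain ⟨tbl, o⟩ := s
  set n := (pairE (pairE tblE (rawE natE)) (rawE unitE) ((tbl, o), l₁ ++ l₂)).length with hn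
  rw [foldl_const_eq_iterate]
  have hn_tbl : (tblE tbl).length ≤ n := by simp [hn, pairE_apply, length_boolPair]; omega
  have hn_o : (rawE natE o).length ≤ n := by simp [hn, pairE_apply, length_boolPair]; omega
  have hn_l : l₁.length ≤ n := by
    have h1 : l₁.length ≤ (rawE unitE (l₁ ++ l₂)).length :=
      (List.sublist_append_left l₁ l₂).length_le.trans (CodeFP.length_le_length_rawE unitE _)
    simp [hn, pairE_apply, length_boolPair] at h1 ⊢; omega
  have hn2 : 2 ≤ n := by simp [hn, pairE_apply, length_boolPair]; omega
  have ht : TblOK (2 * n) tbl := by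
    obtain ⟨tg, na, nb⟩ := tbl
    have e : (tblE (tg, na, nb)).length = 2 * (rawE natE tg).length + 2 + (2 * (rawE natE na).length + 2 + (rawE natE nb).length) := by
      simp [pairE_apply, length_boolPair]
    constructor
    · intro m hm
      have h' : 2 * (natE m).length + 2 ≤ (rawE natE na).length := CodeFP.length_item_le_length_rawE natE hm
      omega
    · intro m hm
      have h' : 2 * (natE m).length + 2 ≤ (rawE natE nb).length := CodeFP.length_item_le_length_rawE natE hm
      omega
  have hinv0 : Inv (2 * n) n (initT o) := by
    have ho := smallList_of_rawE o
    refine ⟨by simp [initT], SmallList.nil, SmallLL.nil, SmallLL.nil, by simp [initT],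
      ⟨ho.1.trans hn_o, fun m hm => (ho.2 m hm).trans (by omega)⟩, by simp [initT]⟩
  have hinv := Inv.iterate (tbl := tbl) ht (by omega) l₁.length hinv0 (by omega)
    ((CodeFP.length_natE_le _).trans (by omega))
  refine (Inv.length_tupE_le hinv).trans ?_
  simp only [eval_mul, eval_C, eval_add, eval_X]
  have : n + l₁.length + 1 ≤ 2 * n + 1 := by omega
  have h3 : (n + l₁.length + 1) * (n + l₁.length + 1) * (2 * n + 1) ≤ (2 * n + 1) * (2 * n + 1) * (2 * n + 1) := by
    apply Nat.mul_le_mul_right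
    exact Nat.mul_le_mul this this
  exact Nat.mul_le_mul_left _ h3

end KAMi

end STA

end Literature.Computability.ImplicitComplexity

-- ============================== Part: VerifierFP ==============================

/-!
## Part `VerifierFP`: The polynomial-time verifier of an `STA₊` program

GMR08 (= Gaboardi–Marion–Ronchi Della Rocca 2008), Thm. 5.12 + Def. 5.13: a language decided
with existential acceptance by a closed program `⊢ M : !ⁿ S_m ⊸ B` is in NP. On the tree's
verifier form of `NP` (`Nondeterministic.NP = polyExists P`), the certificate of a word `x` is the
sequence of choices of an accepting leftmost evaluation of `M x̲`, and the verifier runs the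
sharing machine (`STA.KAM`, implemented by `STA.KAMi.istepT`) on the node table of `M x̲` with
those choices, for polynomially many transitions. This file assembles that verifier as a
polynomial-time map on codes (`CodeFP`) and hence a language in `P`:

* `KAMi.tagsT / argAT / argBT M x` — the node table of `M x̲ = app M (encWord x)` as a function of
  `x` (the program part is a constant, the word part an affine pattern of six nodes per letter),
  `tbl_appEncWord` its agreement with `Term.nodes`, and `tblOf_fp` its computation from `x`;
* `KAMi.fuelLen`, `KAMi.verif` — the fuel `KAM.fuel K |M x̲|` with `K = |M x̲|^e` and the verifier
  bit; `verif_fp`, `verifF`, `verifLang`, `verifLang_mem_P` — the verifier language is in `P`.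

## References

* [GaboardiMarionRonchidellarocca2008] GMR08, Thm. 5.12, Def. 5.13.
* [AroraBarak2009] Def. 2.1 (certificate definition of NP), §1.3.
-/

namespace Literature.Computability.ImplicitComplexity

namespace STA

namespace KAMi

open Literature.Computability.Complexity Literature.Computability.Complexity.CodeFP Polynomial

/-! ### The node table of an applied program -/

/-- The six first-argument entries of the `i`-th letter, word body starting at `B`. [folklore] -/
def aItem (B i : ℕ) (b : Bool) : List ℕ := [B + 6 * i + 1, B + 6 * i + 2, 1, B + 6 * i + 4, B + 6 * i + 5, if b then 0 else 1]

/-- The six second-argument entries of the `i`-th letter. [folklore] -/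
def bItem (B i : ℕ) : List ℕ := [B + 6 * i + 6, B + 6 * i + 3, 0, 0, 0, 0]

/-- Shifting the base by one letter. [folklore] -/
theorem aItem_shift (B i : ℕ) : aItem (B + 6) i = aItem B (i + 1) := by
  funext b
  simp only [aItem, Nat.mul_succ]
  refine List.cons_eq_cons.2 ⟨by omega, List.cons_eq_cons.2 ⟨by omega, List.cons_eq_cons.2 ⟨rfl,
    List.cons_eq_cons.2 ⟨by omega, List.cons_eq_cons.2 ⟨by omega, rfl⟩⟩⟩⟩⟩

/-- Shifting the base by one letter. [folklore] -/
theorem bItem_shift (B i : ℕ) : bItem (B + 6) i = bItem B (i + 1) := by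
  simp only [bItem, Nat.mul_succ]
  exact List.cons_eq_cons.2 ⟨by omega, List.cons_eq_cons.2 ⟨by omega, rfl⟩⟩

/-- Tags of the word part. [folklore] -/
def tagsChain (x : List Bool) : List ℕ := (x.mapIdx fun (_ : ℕ) (_ : Bool) => [1, 1, 0, 2, 2, 0]).flatten ++ [0]

/-- First arguments of the word part, from base position `B`. [folklore] -/
def aChain (B : ℕ) (x : List Bool) : List ℕ := (x.mapIdx (aItem B)).flatten ++ [0]

/-- Second arguments of the word part, from base position `B`. [folklore] -/
def bChain (B : ℕ) (x : List Bool) : List ℕ := (x.mapIdx fun i (_ : Bool) => bItem B i).flatten ++ [0]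

/-- The six nodes of the `i = 0` letter of a word body starting at `B`. [folklore] -/
def sixNodes (B : ℕ) (b : Bool) : List (ℕ × ℕ × ℕ) :=
  [(1, B + 1, B + 6), (1, B + 2, B + 3), (0, 1, 0), (2, B + 4, 0), (2, B + 5, 0), (0, if b then 0 else 1, 0)]

/-- The node table of a word body, one letter at a time. [folklore] -/
theorem nodes_chainTo_cons (b : Bool) (bs : List Bool) (B : ℕ) :
    (chainTo 1 (b :: bs)).nodes B = sixNodes B b ++ (chainTo 1 bs).nodes (B + 6) := by
  have hchain : chainTo 1 (b :: bs) = .app (.app (.var 1) (encBit b)) (chainTo 1 bs) := rfl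
  have hsz : (encBit b).size = 3 := by cases b <;> rfl
  have hsz' : (Term.app (.var 1) (encBit b)).size = 5 := by simp [Term.size, hsz]
  have hnb : (encBit b).nodes (B + 3) = [(2, B + 4, 0), (2, B + 5, 0), (0, if b then 0 else 1, 0)] := by
    cases b <;> simp [encBit, zero, one, Term.nodes]
  rw [hchain, Term.nodes, hsz', Term.nodes, Term.nodes]
  simp only [Term.size, show B + 1 + 1 = B + 2 by omega, show B + 2 + 1 = B + 3 by omega, hnb, show B + 1 + 5 = B + 6 by omega]
  rfl

/-- One letter of each column. [folklore] -/
theorem aChain_cons (B : ℕ) (b : Bool) (bs : List Bool) : aChain B (b :: bs) = aItem B 0 b ++ aChain (B + 6) bs := by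
  simp only [aChain, List.mapIdx_cons, List.flatten_cons, List.append_assoc]
  rw [show aItem (B + 6) = fun i => aItem B (i + 1) from funext (aItem_shift B)]

/-- One letter of each column. [folklore] -/
theorem bChain_cons (B : ℕ) (b : Bool) (bs : List Bool) : bChain B (b :: bs) = bItem B 0 ++ bChain (B + 6) bs := by
  simp only [bChain, List.mapIdx_cons, List.flatten_cons, List.append_assoc]
  rw [show (fun i (_ : Bool) => bItem (B + 6) i) = fun i (_ : Bool) => bItem B (i + 1) from
    funext fun i => funext fun _ => bItem_shift B i]

/-- One letter of each column. [folklore] -/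
theorem tagsChain_cons (b : Bool) (bs : List Bool) : tagsChain (b :: bs) = [1, 1, 0, 2, 2, 0] ++ tagsChain bs := by
  simp only [tagsChain, List.mapIdx_cons, List.flatten_cons, List.append_assoc]

/-- The node table of the word body `c b₀ (c b₁ (⋯ z))`, column by column. [folklore] -/
theorem nodes_chainTo (x : List Bool) (B : ℕ) :
    ((chainTo 1 x).nodes B).map (fun n => n.1) = tagsChain x ∧
    ((chainTo 1 x).nodes B).map (fun n => n.2.1) = aChain B x ∧
    ((chainTo 1 x).nodes B).map (fun n => n.2.2) = bChain B x := by
  induction x generalizing B with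
  | nil => simp [chainTo, Term.nodes, tagsChain, aChain, bChain]
  | cons b bs ih =>
    obtain ⟨h1, h2, h3⟩ := ih (B + 6)
    rw [nodes_chainTo_cons, aChain_cons, bChain_cons, tagsChain_cons]
    simp only [List.map_append, h1, h2, h3]
    exact ⟨rfl, by simp [sixNodes, aItem], by simp [sixNodes, bItem]⟩

/-- Tags of the node table of `M x̲`. [folklore] -/
def tagsT (M : Term) (x : List Bool) : List ℕ := 1 :: (((M.nodes 1).map fun n => n.1) ++ (2 :: 2 :: tagsChain x))

/-- First arguments of the node table of `M x̲`. [folklore] -/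
def argAT (M : Term) (x : List Bool) : List ℕ :=
  1 :: (((M.nodes 1).map fun n => n.2.1) ++ ((M.size + 2) :: (M.size + 3) :: aChain (M.size + 3) x))

/-- Second arguments of the node table of `M x̲`. [folklore] -/
def argBT (M : Term) (x : List Bool) : List ℕ :=
  (1 + M.size) :: (((M.nodes 1).map fun n => n.2.2) ++ (0 :: 0 :: bChain (M.size + 3) x))

/-- **The node table of the applied program `M x̲`.** [folklore] -/
theorem tbl_appEncWord (M : Term) (x : List Bool) :
    (tags (.app M (encWord x)), argA (.app M (encWord x)), argB (.app M (encWord x))) = (tagsT M x, argAT M x, argBT M x) := by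
  obtain ⟨h1, h2, h3⟩ := nodes_chainTo x (1 + M.size + 2)
  simp only [tags, argA, argB, tagsT, argAT, argBT, Term.nodes, encWord_eq_chainTo, List.map_cons, List.map_append,
    h1, h2, h3, Prod.mk.injEq]
  refine ⟨?_, ?_, ?_⟩ <;> first
    | trivial
    | rfl
    | rw [show 1 + M.size + 1 = M.size + 2 by omega, show M.size + 2 + 1 = M.size + 3 by omega,
        show 1 + M.size + 2 = M.size + 3 by omega]
    | rw [show 1 + M.size + 2 = M.size + 3 by omega]

/-! ### Computing the table from the word -/

/-- Indexed maps commute with maps. [folklore] -/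
theorem mapIdx_map {α β γ : Type} (f : α → β) (g : ℕ → β → γ) (l : List α) :
    (l.map f).mapIdx g = l.mapIdx fun i a => g i (f a) := by
  apply List.ext_getElem
  · simp
  · intro i h1 h2
    simp

/-- **The bits of a string as `0`/`1` numerals** (chunks of width one). [folklore] -/
theorem strBitsNat : CodeFP strE (rawE natE) (fun s : List Bool => s.map bitNat) := by
  have hinj : Function.Injective strE := fun _ _ h => h
  have hch := strChunks.comp (strLength.pair ((const strE (1 : ℕ)).pair (CodeFP.id strE)))
  have hitem : CodeFP strE natE (fun a : List Bool => if decide (a = [true]) then (1 : ℕ) else 0) :=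
    ((CodeFP.eq hinj).comp ((CodeFP.id strE).pair (const strE [true]))).ite (const _ 1) (const _ 0)
  refine ((map₀ hitem).comp hch).congr fun s => ?_
  show ((List.range s.length).map (fun i => (s.drop (i * 1)).take 1)).map _ = s.map bitNat
  rw [List.map_map]
  apply List.ext_getElem
  · simp
  · intro i h1 h2
    have hi : i < s.length := by simpa using h2
    simp only [List.getElem_map, List.getElem_range, Nat.mul_one, Function.comp_apply]
    rw [List.drop_eq_getElem_cons hi, List.take_succ_cons, List.take_zero]
    cases s[i] <;> simp [bitNat]

/-- An affine function of the index. [folklore] -/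
theorem affine_fp {α : Type} {eα : α → List Bool} (B k : ℕ) : CodeFP (pairE unitE (pairE natE eα)) natE (fun t => B + 6 * t.2.1 + k) :=
  natAdd.comp ((natAdd.comp ((const _ B).pair (natMul.comp ((const _ 6).pair (snd _ _).fst')))).pair (const _ k))

/-- The first arguments of the word part are polynomial time in the word. [folklore] -/
theorem aChain_fp (B : ℕ) : CodeFP strE (rawE natE) (aChain B) := by
  have hv : CodeFP (pairE unitE (pairE natE natE)) natE (fun t => if decide (t.2.2 = 1) then (0 : ℕ) else 1) :=
    (natEq.comp ((snd _ _).snd'.pair (const _ 1))).ite (const _ 0) (const _ 1)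
  have hitem : CodeFP (pairE unitE (pairE natE natE)) (rawE natE)
      (fun t => [B + 6 * t.2.1 + 1, B + 6 * t.2.1 + 2, 1, B + 6 * t.2.1 + 4, B + 6 * t.2.1 + 5, if decide (t.2.2 = 1) then 0 else 1]) :=
    (rawCons natE).comp ((affine_fp B 1).pair ((rawCons natE).comp ((affine_fp B 2).pair ((rawCons natE).comp ((const _ 1).pair
      ((rawCons natE).comp ((affine_fp B 4).pair ((rawCons natE).comp ((affine_fp B 5).pair ((rawCons natE).comp (hv.pair
        (const _ ([] : List ℕ)))))))))))))
  have h := ((rawAppend natE).comp ((((flatten natE).comp ((mapIdx hitem).comp ((const _ ()).pair (CodeFP.id _)))).pair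
    (const _ [0])))).comp strBitsNat
  refine h.congr fun x => ?_
  show (List.mapIdx _ (x.map bitNat)).flatten ++ [0] = aChain B x
  rw [aChain, mapIdx_map]
  congr 2
  apply List.ext_getElem
  · simp
  · intro i h1 h2
    have hi : i < x.length := by simpa using h2
    simp only [List.getElem_mapIdx, aItem]
    cases x[i] <;> simp [bitNat]

/-- The second arguments of the word part are polynomial time in the word. [folklore] -/
theorem bChain_fp (B : ℕ) : CodeFP strE (rawE natE) (bChain B) := by
  have hitem : CodeFP (pairE unitE (pairE natE natE)) (rawE natE)
      (fun t => [B + 6 * t.2.1 + 6, B + 6 * t.2.1 + 3, 0, 0, 0, 0]) :=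
    (rawCons natE).comp ((affine_fp B 6).pair ((rawCons natE).comp ((affine_fp B 3).pair (const _ [0, 0, 0, 0]))))
  have h := ((rawAppend natE).comp ((((flatten natE).comp ((mapIdx hitem).comp ((const _ ()).pair (CodeFP.id _)))).pair
    (const _ [0])))).comp strBitsNat
  refine h.congr fun x => ?_
  show (List.mapIdx _ (x.map bitNat)).flatten ++ [0] = bChain B x
  rw [bChain, mapIdx_map]
  rfl

/-- The tags of the word part are polynomial time in the word. [folklore] -/
theorem tagsChain_fp : CodeFP strE (rawE natE) tagsChain := by
  have hitem : CodeFP (pairE unitE (pairE natE natE)) (rawE natE) (fun _ => [1, 1, 0, 2, 2, 0]) := const _ _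
  have h := ((rawAppend natE).comp ((((flatten natE).comp ((mapIdx hitem).comp ((const _ ()).pair (CodeFP.id _)))).pair
    (const _ [0])))).comp strBitsNat
  refine h.congr fun x => ?_
  show (List.mapIdx _ (x.map bitNat)).flatten ++ [0] = tagsChain x
  rw [tagsChain, mapIdx_map]

/-- **The node table of `M x̲` is polynomial time in `x`.** [cite: GaboardiMarionRonchidellarocca2008, Thm. 5.12] -/
theorem tblOf_fp (M : Term) : CodeFP strE tblE (fun x => (tagsT M x, argAT M x, argBT M x)) := by
  have pre : ∀ (l : List ℕ) {g : List Bool → List ℕ}, CodeFP strE (rawE natE) g → CodeFP strE (rawE natE) (fun x => l ++ g x) :=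
    fun l g hg => (rawAppend natE).comp ((const _ l).pair hg)
  have h1 : CodeFP strE (rawE natE) (tagsT M) :=
    (pre (1 :: (((M.nodes 1).map fun n => n.1) ++ [2, 2])) tagsChain_fp).congr fun x => by simp [tagsT]
  have h2 : CodeFP strE (rawE natE) (argAT M) :=
    (pre (1 :: (((M.nodes 1).map fun n => n.2.1) ++ [M.size + 2, M.size + 3])) (aChain_fp (M.size + 3))).congr fun x => by
      simp [argAT]
  have h3 : CodeFP strE (rawE natE) (argBT M) :=
    (pre ((1 + M.size) :: (((M.nodes 1).map fun n => n.2.2) ++ [0, 0])) (bChain_fp (M.size + 3))).congr fun x => by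
      simp [argBT]
  exact h1.pair (h2.pair h3)

/-! ### Fuel and the verifier -/

/-- `|M x̲| = |M| + 6|x| + 4`. [folklore] -/
def Sz (M : Term) (x : List Bool) : ℕ := M.size + 6 * x.length + 4

/-- `|M x̲| = |M| + 6|x| + 4`. [cite: GaboardiMarionRonchidellarocca2008, §3.2] -/
theorem size_appEncWord (M : Term) (x : List Bool) : (Term.app M (encWord x)).size = Sz M x := by
  have hc : ∀ bs : List Bool, (chainTo 1 bs).size = 6 * bs.length + 1 := by
    intro bs
    induction bs with
    | nil => rfl
    | cons b bs ih =>
      have : chainTo 1 (b :: bs) = .app (.app (.var 1) (encBit b)) (chainTo 1 bs) := rfl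
      rw [this]
      cases b <;> simp [Term.size, encBit, zero, one, ih] <;> ring
  rw [encWord_eq_chainTo]
  simp only [Term.size, hc, Sz]
  ring

/-- The number of transitions granted: `KAM.fuel (|M x̲|^e) |M x̲|`. [folklore] -/
def fuelLen (M : Term) (e : ℕ) (x : List Bool) : ℕ := KAM.fuel (Sz M x ^ e) (Sz M x)

/-- `replicate` distributes over sums. [folklore] -/
theorem replicate_add_unit (a b : ℕ) : List.replicate a () ++ List.replicate b () = List.replicate (a + b) () :=
  (List.replicate_add a b ()).symm

/-- The size of the applied program, in unary, is polynomial time in the word. [folklore] -/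
theorem szUnits_fp (M : Term) : CodeFP strE (rawE unitE) (fun x => List.replicate (Sz M x) ()) := by
  have u : CodeFP strE (rawE unitE) (fun x => List.replicate x.length ()) := replicateUnit.comp strLength
  have app2 : ∀ {g h : List Bool → List Unit}, CodeFP strE (rawE unitE) g → CodeFP strE (rawE unitE) h →
      CodeFP strE (rawE unitE) (fun x => g x ++ h x) := fun hg hh => (rawAppend unitE).comp (hg.pair hh)
  have h := app2 (app2 (app2 (app2 (app2 (app2 u u) u) u) u) u) (const strE (List.replicate (M.size + 4) ()))
  refine h.congr fun x => ?_
  simp only [replicate_add_unit, Sz]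
  congr 1
  ring

/-- **The fuel list is polynomial time in the word.** [folklore] -/
theorem fuelUnits_fp (M : Term) (e : ℕ) : CodeFP strE (rawE unitE) (fun x => List.replicate (fuelLen M e x) ()) := by
  have hS := szUnits_fp M
  have hK : CodeFP strE (rawE unitE) (fun x => List.replicate (Sz M x ^ e) ()) :=
    ((unitsPow e).comp ((ulength unitE).comp hS)).congr fun x => by simp
  have app2 : ∀ {g h : List Bool → List Unit}, CodeFP strE (rawE unitE) g → CodeFP strE (rawE unitE) h →
      CodeFP strE (rawE unitE) (fun x => g x ++ h x) := fun hg hh => (rawAppend unitE).comp (hg.pair hh)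
  have mul2 : ∀ {g h : List Bool → List Unit}, CodeFP strE (rawE unitE) g → CodeFP strE (rawE unitE) h →
      CodeFP strE (rawE unitE) (fun x => List.replicate ((g x).length * (h x).length) ()) :=
    fun hg hh => unitsMul.comp (hg.pair hh)
  have hK4 := app2 hK (const strE (List.replicate 4 ()))
  have hS1 := app2 hS (const strE [()])
  have hK1 := app2 hK (const strE [()])
  have hP2 := mul2 (mul2 hK4 hS1) hK1
  refine (app2 (app2 hP2 hP2) hP2).congr fun x => ?_
  simp only [List.length_append, List.length_replicate, List.length_singleton, replicate_add_unit, fuelLen, KAM.fuel]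
  congr 1
  ring

/-- **The verifier bit**: run the implementation on the table of `M x̲` with the oracle `y` for
`fuelLen` transitions and test the status. [cite: GaboardiMarionRonchidellarocca2008, Thm. 5.12 and Def. 5.13] -/
def verif (M : Term) (e : ℕ) (p : List Bool × List Bool) : Bool :=
  decide (((fun s => istepT ((tagsT M p.1, argAT M p.1, argBT M p.1), s))^[fuelLen M e p.1] (initT (p.2.map bitNat))).2.2.2.2.2.2 = 1)

/-- **The verifier is polynomial time.** [cite: GaboardiMarionRonchidellarocca2008, Thm. 5.12] -/
theorem verif_fp (M : Term) (e : ℕ) : CodeFP (pairE strE strE) bitE (verif M e) := by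
  have hin : CodeFP (pairE strE strE) (pairE (pairE tblE (rawE natE)) (rawE unitE))
      (fun p => (((tagsT M p.1, argAT M p.1, argBT M p.1), p.2.map bitNat), List.replicate (fuelLen M e p.1) ())) :=
    (((tblOf_fp M).comp (fst _ _)).pair (strBitsNat.comp (snd _ _))).pair ((fuelUnits_fp M e).comp (fst _ _))
  have hrun := runT_fp.comp hin
  have hst : CodeFP (pairE strE strE) natE (fun p =>
      ((fun s => istepT ((tagsT M p.1, argAT M p.1, argBT M p.1), s))^[fuelLen M e p.1] (initT (p.2.map bitNat))).2.2.2.2.2.2) := by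
    refine (hrun.snd'.snd'.snd'.snd'.snd'.snd').congr fun p => ?_
    simp only [List.length_replicate]
  exact (natEq.comp (hst.pair (const _ 1))).congr fun p => by simp [verif]

/-- **The verifier as a polynomial-time string function** on pair codes. [cite: GaboardiMarionRonchidellarocca2008, Thm. 5.12] -/
theorem exists_verifF (M : Term) (e : ℕ) : ∃ f : List Bool → List Bool, f ∈ FP ∧ ∀ x y, f (boolPair x y) = [verif M e (x, y)] := by
  obtain ⟨f, hf, hspec⟩ := verif_fp M e
  exact ⟨f, hf, fun x y => hspec (x, y)⟩

/-- The verifier string function (chosen). [folklore] -/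
noncomputable def verifF (M : Term) (e : ℕ) : List Bool → List Bool := Classical.choose (exists_verifF M e)

/-- Specification of the chosen verifier function. [folklore] -/
theorem verifF_spec (M : Term) (e : ℕ) : verifF M e ∈ FP ∧ ∀ x y, verifF M e (boolPair x y) = [verif M e (x, y)] :=
  Classical.choose_spec (exists_verifF M e)

/-- **The verifier language**: pair codes accepted by the verifier. [cite: GaboardiMarionRonchidellarocca2008, Def. 5.13] -/
def verifLang (M : Term) (e : ℕ) : Language Bool := {w | verifF M e w = [true]}

/-- Membership of a pair code in the verifier language. [folklore] -/
theorem boolPair_mem_verifLang (M : Term) (e : ℕ) (x y : List Bool) :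
    boolPair x y ∈ verifLang M e ↔ verif M e (x, y) = true := by
  show verifF M e (boolPair x y) = [true] ↔ _
  rw [(verifF_spec M e).2]
  simp

/-- **The verifier language is in `P`.** [cite: GaboardiMarionRonchidellarocca2008, Thm. 5.12] -/
theorem verifLang_mem_P (M : Term) (e : ℕ) : verifLang M e ∈ Classes.P := by
  refine mem_P_of_mem_FP (g := Brick.isTrue1Fn ∘ verifF M e) (comp_mem_FP Brick.isTrue1Fn_mem_FP (verifF_spec M e).1) _ fun w => ?_
  constructor
  · intro hw
    have hw' : verifF M e w = [true] := hw
    simp [hw']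
  · intro hw
    have hw' : verifF M e w ≠ [true] := hw
    simp [hw']

end KAMi

end STA

end Literature.Computability.ImplicitComplexity

-- ============================== Part: NPSound ==============================

/-!
## Part `NPSound`: NP-soundness of `STA₊`: soft-sum-representable languages are in NP

The first half of `STAPlusCapturesNP` (GMR08 = Gaboardi–Marion–Ronchi Della Rocca 2008, Thm. 5.12
with Def. 5.13), proved: if a language `L ⊆ {0,1}*` is defined with existential acceptance by a
closed `STA₊` program `⊢ M : !ⁿ S_m ⊸ B` (the tree's `SoftSumRepresentsAtLevel t L`), then
`L ∈ Nondeterministic.NP` (the tree's verifier class `polyExists P` over `FinTM2` deciders).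

The proof is the one formalised in this series of files: acceptance "some `βγ`-normal form of
`M x̲` is `0`" is acceptance by the leftmost-outermost strategy with suitable choices
(standardization, `reduces_zero_iff_lmoStar`); a typed term reaches each normal form in
polynomially many leftmost steps (subject reduction with decreasing weight, GMR08 Lemma 5.7,
`Typing.lmo_normal_form_steps`); the sharing machine fed with the choice bits accepts within a
polynomial number of transitions iff such an evaluation exists (`KAM.run_complete`,
`KAM.run_sound`); and the machine is a polynomial-time verifier (`KAMi.verifLang_mem_P`). The
certificate of `x` is the choice sequence, of length at most `|M x̲|^{t+1}`.

* `STA.mem_NP_of_decidesByZero` — the statement for a given closed program;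
* `SoftSumRepresentsAtLevel.mem_NP` — **GMR08 Thm. 5.12 (NP soundness) on the tree's classes.**

## References

* [GaboardiMarionRonchidellarocca2008] GMR08, Thm. 5.12, Def. 5.13, Lemma 5.4, Lemma 5.7.
* [AroraBarak2009] Def. 2.1.
-/

namespace Literature.Computability.ImplicitComplexity

namespace STA

open Literature.Computability.Complexity Polynomial

/-- Closed typed terms have no free variables. [folklore] -/
theorem fv_eq_empty_of_typing_empty {d : ℕ} {M : Term} {σ : SoftTy} (h : Typing d Ctx.empty M σ) : M.fv = ∅ := by
  obtain ⟨w, E⟩ := h.exists_wtyping_empty (r := M.size) le_rfl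
  exact Finset.eq_empty_of_forall_notMem fun i hi => E.ne_none_of_mem_fv hi rfl

/-- **The verifier bit is the machine's verdict** on the applied program, for the fuel granted.
[cite: GaboardiMarionRonchidellarocca2008, Thm. 5.12] -/
theorem KAMi.verif_eq_true_iff (M : Term) (e : ℕ) (x y : List Bool) :
    KAMi.verif M e (x, y) = true ↔ KAM.run (KAMi.fuelLen M e x) y (KAM.init (.app M (encWord x))) = true := by
  rw [KAMi.run_init_iff, KAMi.verif, decide_eq_true_iff]
  have ht := KAMi.tbl_appEncWord M x
  simp only [Prod.mk.injEq] at ht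
  obtain ⟨h1, h2, h3⟩ := ht
  have hit := KAMi.istepT_iterate (tagsT M x, argAT M x, argBT M x) (KAMi.iinit y) (KAMi.fuelLen M e x)
  rw [KAMi.iinit_tup] at hit
  dsimp only at hit ⊢
  rw [hit, ← h1, ← h2, ← h3]
  rfl

/-- **NP-soundness for a given program.** If the closed program `⊢ M : !ⁿ S_m ⊸ B` (`m ≥ 1`, degree
`d`) decides `L` with existential acceptance by `0`, then `L ∈ NP`: the verifier language of `M`
with exponent `e = max d n + 1` and the certificate bound `|M x̲|^e`.
[cite: GaboardiMarionRonchidellarocca2008, Thm. 5.12 and Def. 5.13] -/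
theorem mem_NP_of_decidesByZero {d n m : ℕ} {M : Term} {L : Language Bool} (hT : Typing d Ctx.empty M (progTy n m))
    (hm : 1 ≤ m) (hL : DecidesByZero M L) : L ∈ Nondeterministic.NP := by
  set e := max d n + 1 with he
  refine ⟨KAMi.verifLang M e, KAMi.verifLang_mem_P M e, (C (M.size + 4) + C 6 * X) ^ e, fun x => ?_⟩
  have hTx : Typing (max d n) Ctx.empty (.app M (encWord x)) ⟨0, tyB⟩ := typing_app_encWord_level hT hm x
  have hclosed : (Term.app M (encWord x)).fv = ∅ := fv_eq_empty_of_typing_empty hTx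
  have hsize : (Term.app M (encWord x)).size = KAMi.Sz M x := KAMi.size_appEncWord M x
  have heval : ((C (M.size + 4) + C 6 * X) ^ e : Polynomial ℕ).eval x.length = KAMi.Sz M x ^ e := by
    simp [KAMi.Sz]; ring
  constructor
  · intro hx
    have hred : Reduces (.app M (encWord x)) zero := (hL x).1 hx
    obtain ⟨k, hk, hrel⟩ := hTx.lmo_normal_form_steps hred normal_zero
    rw [hsize] at hk
    obtain ⟨o, ho, hrun⟩ := KAM.run_complete hclosed hrel hk
    refine ⟨o, by rw [heval]; exact ho, ?_⟩
    rw [KAMi.boolPair_mem_verifLang, KAMi.verif_eq_true_iff]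
    rw [hsize] at hrun
    exact hrun
  · rintro ⟨y, -, hy⟩
    rw [KAMi.boolPair_mem_verifLang, KAMi.verif_eq_true_iff] at hy
    exact (hL x).2 (KAM.run_sound hclosed hy)

/-- **GMR08 Theorem 5.12 (NP-soundness of `STA₊`) on the tree's classes**: every language that is
soft-sum-representable at some level is in `NP`. This is the `←` half of `STAPlusCapturesNP`.
[cite: GaboardiMarionRonchidellarocca2008, Thm. 5.12 and Def. 5.13] -/
theorem _root_.Literature.Computability.ImplicitComplexity.SoftSumRepresentsAtLevel.mem_NP {t : ℕ} {L : Language Bool}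
    (h : SoftSumRepresentsAtLevel t L) : L ∈ Nondeterministic.NP := by
  obtain ⟨M, d, n, m, -, -, hm, hT, hL⟩ := h
  exact mem_NP_of_decidesByZero hT hm hL

/-- The `←` direction of `STAPlusCapturesNP`, in its exact form. [cite: GaboardiMarionRonchidellarocca2008, Thm. 5.12] -/
theorem mem_NP_of_exists_level {L : Language Bool} (h : ∃ t, SoftSumRepresentsAtLevel t L) : L ∈ Nondeterministic.NP := by
  obtain ⟨t, ht⟩ := h
  exact ht.mem_NP

end STA

end Literature.Computability.ImplicitComplexity
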